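import Summits.KontsevichZagierPeriods.KontsevichZagierPeriods.Theses.LinRedNormalForm
import Literature.NumberTheory.Transcendental.MZVSimplexRep
import Literature.NumberTheory.Transcendental.MZVSimplexRepProofs

/-!
# Disproof of `WheelThreeSpokes` (stmt-KontsevichZagierPeriods-3913) — standing adversary file

Crux (route LinRedNormalForm / SiegelTamagawa, rank 3):
`[ℝ₊⁵, 1/Ψ_{K₄}(x,1)²] ~KZ~ [1>t₀>t₁>t₂>0, 6/(t₀t₁(1−t₂))]`.

Findings (indexed; prose only in docstrings):
* §0 `wheelThreeSpokes_iff` — the crux restated over named hypotheses `H1`–`H4`.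
* §1 VALUE side: both values are positive (`value_pos_left/right`); both representations are
  `IsRational`; hence (§4) the crux is an INSTANCE of the summit given the classical value identity
  `P(K₄) = 6ζ(3)` (`wheelThreeSpokes_of_summit`), and conversely any refutation of the crux refutes the
  summit (`not_summit_of_not_wheelThreeSpokes`) — a kill here is summit-strength (cf. route Neg,
  `NegObstructionShape`). Value check of the TYPED integrand (evidence `numerics.txt`): typed polynomial =
  Kirchhoff polynomial of `K₄` EXACTLY (rational polynomial algebra), `∫_{ℝ₊⁵}dx/Ψ² = 7.2123414247` vs
  `6ζ(3) = 7.2123414190` (tanh–sinh after two elementary integrations; rel. 8e-10).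
* §2 LOAD-BEARING: each of `H1`–`H4` is needed (`false_without_H1/H2` unconditional witnesses;
  `false_without_H3/H4` modulo non-vacuity of the wheel side, `∃ r, H1 r ∧ H2 r`).
* §3 STRUCTURE OF ANY CHAIN (refuted strengthenings): the graded evaluation `evalFrom k` kills every
  move except the Newton–Leibniz instances between dimensions `k` and `k−1`; hence NO chain avoids a
  Newton–Leibniz move `5 → 4` nor one `4 → 3` (`not_mem_closure_movesAvoidingLevel_four/three`): the
  strengthening "equivalent by additivity + change of variables + NL in other dimensions" is FALSE.
* §5 NEAR-MISS IN THE PROVERS' FAVOUR: an explicit chain of rule instances with absolutely convergent,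
  positive, RATIONAL intermediates takes `[ℝ₊⁵, 1/Ψ²]` down to dimension three,
  `[ℝ₊⁵, 1/Ψ²] ≡ [R3a] + [R3b]` (compactify, NL, Möbius, pencil `a₁b₀ + sD²`, unfolded integration by
  parts, NL in `s`) — no regularised limit anywhere; algebraic certificates checked by `ring`/`field_simp`.
* §6 NON-VACUITY: the `K₄` period converges absolutely (Lean: `integrableOn_wheelIntegrand`), so
  `wheelRep : KZ.IntegralRep 5` exists and `false_without_H3'/H4'` are unconditional.
* §7 REDUCTION THEOREM `wheelThreeSpokes_of_residual` (bookkeeping moves formalised as genuine rule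
  instances): after §5 the crux IS the residual `[ℝ₊³, N/(a₁b₀a₀b₁)] ~ [Δ₃, 4/(t₀t₁(1−t₂))]`.
WHY IT RESISTS: values agree (`numerics.txt`: 6ζ(3) both sides to 8e-10; chain values R3a = 2ζ(3),
R3b = 4ζ(3) = 7/2·ζ(3) + ½ζ(3) to 1e-12), every hypothesis is load-bearing but satisfiable, the only
invariant of the calculus known is the value, and a natural reduction proceeds without obstruction.
-/

noncomputable section

set_option linter.dupNamespace false

open MeasureTheory Set MvPolynomial
open Literature.NumberTheory.Transcendental Literature.ModelTheory.ExponentialFields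

namespace Summit.KontsevichZagierPeriods.KontsevichZagierPeriods.Cruxes.WheelThreeSpokes.Disproof

open Summit.KontsevichZagierPeriods.KontsevichZagierPeriods.Theses.LinRedNormalForm (WheelThreeSpokes)

/-! ## §0 The crux over named data -/

/-- The Kirchhoff polynomial `Ψ_{K₄}(x₀,…,x₄,1)` in the affine chart `α₃₄ = 1`, copied literally
from the crux. [folklore] -/
def psi (x : Fin 5 → ℝ) : ℝ :=
  x 0 * x 1 * x 3 + x 0 * x 1 * x 4 + x 0 * x 1 + x 0 * x 2 * x 3 + x 0 * x 2 * x 4 + x 0 * x 2 +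
    x 0 * x 3 + x 0 * x 4 + x 1 * x 2 * x 3 + x 1 * x 2 * x 4 + x 1 * x 2 + x 1 * x 3 * x 4 + x 1 * x 4 +
    x 2 * x 3 * x 4 + x 2 * x 3 + x 3 * x 4

/-- The wheel integrand `1/Ψ²`. [folklore] -/
def wheelIntegrand (x : Fin 5 → ℝ) : ℝ := 1 / psi x ^ 2

/-- The open positive orthant `ℝ₊⁵`. [folklore] -/
def orthant : Set (Fin 5 → ℝ) := {x | ∀ i, 0 < x i}

/-- The open ordered simplex `{1 > t₀ > t₁ > t₂ > 0}` as typed in the crux. [folklore] -/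
def simplex3 : Set (Fin 3 → ℝ) := {t | 1 > t 0 ∧ t 0 > t 1 ∧ t 1 > t 2 ∧ t 2 > 0}

/-- The target integrand `6/(t₀t₁(1−t₂))` (`= 6 · ω₀ω₀ω₁`, the `ζ(3)` word). [folklore] -/
def zeta3Integrand (t : Fin 3 → ℝ) : ℝ := 6 / (t 0 * t 1 * (1 - t 2))

/-- Hypothesis H1 of the crux: the wheel domain is the open orthant. [folklore] -/
def H1 (r : KZ.IntegralRep 5) : Prop := r.domain = orthant
/-- Hypothesis H2 of the crux: the wheel integrand is `1/Ψ²` on the domain. [folklore] -/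
def H2 (r : KZ.IntegralRep 5) : Prop := EqOn r.integrand wheelIntegrand r.domain
/-- Hypothesis H3 of the crux: the target domain is the ordered simplex. [folklore] -/
def H3 (r' : KZ.IntegralRep 3) : Prop := r'.domain = simplex3
/-- Hypothesis H4 of the crux: the target integrand is `6/(t₀t₁(1−t₂))` on the domain. [folklore] -/
def H4 (r' : KZ.IntegralRep 3) : Prop := EqOn r'.integrand zeta3Integrand r'.domain

/-- The crux, restated definitionally over `H1`–`H4`. [folklore] -/
theorem wheelThreeSpokes_iff :
    WheelThreeSpokes ↔
      ∀ (r : KZ.IntegralRep 5) (r' : KZ.IntegralRep 3), H1 r → H2 r → H3 r' → H4 r' →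
        KZ.Equivalent r r' :=
  Iff.rfl

/-! ## §1 Values: positivity, rationality -/

theorem psi_pos {x : Fin 5 → ℝ} (hx : x ∈ orthant) : 0 < psi x := by
  have h0 := hx 0; have h1 := hx 1; have h2 := hx 2; have h3 := hx 3; have h4 := hx 4
  unfold psi; positivity

theorem wheelIntegrand_pos {x : Fin 5 → ℝ} (hx : x ∈ orthant) : 0 < wheelIntegrand x := by
  unfold wheelIntegrand; have := psi_pos hx; positivity

theorem wheelIntegrand_nonneg (x : Fin 5 → ℝ) : 0 ≤ wheelIntegrand x := by
  unfold wheelIntegrand; positivity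

theorem zeta3Integrand_pos {t : Fin 3 → ℝ} (ht : t ∈ simplex3) : 0 < zeta3Integrand t := by
  obtain ⟨h0, h01, h12, h2⟩ := ht
  unfold zeta3Integrand
  have : 0 < t 1 := by linarith
  have : 0 < t 0 := by linarith
  have : 0 < 1 - t 2 := by linarith
  positivity

theorem isOpen_orthant : IsOpen orthant := by
  have : orthant = ⋂ i, {x : Fin 5 → ℝ | 0 < x i} := by ext; simp [orthant]
  rw [this]
  exact isOpen_iInter_of_finite fun i => isOpen_lt continuous_const (continuous_apply i)

theorem orthant_nonempty : orthant.Nonempty := ⟨fun _ => 1, fun _ => one_pos⟩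

theorem isOpen_simplex3 : IsOpen simplex3 := by
  have e : simplex3 = {t : Fin 3 → ℝ | t 0 < 1} ∩ {t | t 1 < t 0} ∩ {t | t 2 < t 1} ∩ {t | 0 < t 2} := by
    ext t; simp [simplex3, and_assoc]
  rw [e]
  refine ((IsOpen.inter ?_ ?_).inter ?_).inter ?_
  · exact isOpen_lt (continuous_apply 0) continuous_const
  · exact isOpen_lt (continuous_apply 1) (continuous_apply 0)
  · exact isOpen_lt (continuous_apply 2) (continuous_apply 1)
  · exact isOpen_lt continuous_const (continuous_apply 2)

theorem simplex3_nonempty : simplex3.Nonempty :=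
  ⟨![3/4, 1/2, 1/4], by simp [simplex3]; norm_num⟩

/-- Positivity of the wheel value `P(K₄) > 0` for ANY representation satisfying H1, H2 (no
construction needed: integrability is a field of `r`). [folklore] -/
theorem value_pos_left (r : KZ.IntegralRep 5) (h1 : H1 r) (h2 : H2 r) : 0 < r.value := by
  have hm : MeasurableSet r.domain := KZ.IntegralRep.measurableSet_domain_holds r
  unfold KZ.IntegralRep.value
  rw [setIntegral_congr_fun hm h2]
  have hint : IntegrableOn wheelIntegrand r.domain := r.integrableOn.congr_fun h2 hm
  rw [setIntegral_pos_iff_support_of_nonneg_ae (Filter.Eventually.of_forall wheelIntegrand_nonneg) hint]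
  have hsupp : Function.support wheelIntegrand ∩ r.domain = r.domain := by
    refine inter_eq_right.mpr fun x hx => ?_
    rw [h1] at hx
    exact (wheelIntegrand_pos hx).ne'
  rw [hsupp, h1]
  exact isOpen_orthant.measure_pos volume orthant_nonempty

/-- Positivity of the target value `6ζ(3) > 0` for ANY representation satisfying H3, H4. [folklore] -/
theorem value_pos_right (r' : KZ.IntegralRep 3) (h3 : H3 r') (h4 : H4 r') : 0 < r'.value := by
  have hm : MeasurableSet r'.domain := KZ.IntegralRep.measurableSet_domain_holds r'
  unfold KZ.IntegralRep.value
  rw [setIntegral_congr_fun hm h4]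
  have hint : IntegrableOn zeta3Integrand r'.domain := r'.integrableOn.congr_fun h4 hm
  have hnn : 0 ≤ᵐ[volume.restrict r'.domain] zeta3Integrand := by
    rw [Filter.EventuallyLE, ae_restrict_iff' hm]
    exact Filter.Eventually.of_forall fun t ht => (zeta3Integrand_pos (h3 ▸ ht)).le
  rw [setIntegral_pos_iff_support_of_nonneg_ae hnn hint]
  have hsupp : Function.support zeta3Integrand ∩ r'.domain = r'.domain := by
    refine inter_eq_right.mpr fun x hx => ?_
    rw [h3] at hx
    exact (zeta3Integrand_pos hx).ne'
  rw [hsupp, h3]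
  exact isOpen_simplex3.measure_pos volume simplex3_nonempty


/-! ## §3 Structure of any chain: the graded evaluation and the Newton–Leibniz levels

`evalFrom k [r] = value r` if `dim r ≥ k`, else `0`. It is additive, kills the three same-dimension
moves (each is sound), and kills a Newton–Leibniz instance between dimensions `j+1` and `j` unless
`j + 1 = k`. On the crux pair it takes the value `P(K₄) > 0` for `k = 4, 5`. Hence every chain of moves
realising the crux contains (with non-zero total coefficient) a Newton–Leibniz move `5 → 4` AND one
`4 → 3`: the natural strengthenings "by additivity and change of variables only" or "descending
through another dimension" are false. -/

/-- Graded evaluation: the value of the components of dimension `≥ k`. [folklore] -/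
def evalFrom (k : ℕ) : KZ.FormalRep →+ ℝ :=
  FreeAbelianGroup.lift fun r => if k ≤ r.1 then r.2.value else 0

@[simp] theorem evalFrom_of (k : ℕ) {n : ℕ} (r : KZ.IntegralRep n) :
    evalFrom k (KZ.of r) = if k ≤ n then r.value else 0 :=
  FreeAbelianGroup.lift_apply_of _ _

/-- Newton–Leibniz instances between dimensions `j + 1` and `j`: the literal body of
`KZ.newtonLeibnizRel` with the dimension fixed. [folklore] -/
def newtonLeibnizRelAt (j : ℕ) : Set KZ.FormalRep :=
  {c | ∃ (r : KZ.IntegralRep (j + 1)) (r' : KZ.IntegralRep j) (a b : (Fin j → ℝ) → ℝ)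
      (F : (Fin (j + 1) → ℝ) → ℝ),
    IsSemialgebraicFunOn ℚ r.domain F ∧
    IsSemialgebraicFunOn ℚ r'.domain a ∧ IsSemialgebraicFunOn ℚ r'.domain b ∧
    (∀ x ∈ r'.domain, a x ≤ b x) ∧
    r.domain = {z | (Fin.init z : Fin j → ℝ) ∈ r'.domain ∧ a (Fin.init z) ≤ z (Fin.last j) ∧
      z (Fin.last j) ≤ b (Fin.init z)} ∧
    (∀ x ∈ r'.domain, ContinuousOn (fun t : ℝ => F (Fin.snoc x t)) (Icc (a x) (b x))) ∧
    (∀ x ∈ r'.domain, ∀ t ∈ Ioo (a x) (b x),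
      HasDerivAt (fun s : ℝ => F (Fin.snoc x s)) (r.integrand (Fin.snoc x t)) t) ∧
    (∀ x ∈ r'.domain, r'.integrand x = F (Fin.snoc x (b x)) - F (Fin.snoc x (a x))) ∧
    c = KZ.of r - KZ.of r'}

/-- The Newton–Leibniz move set is the union of its levels (faithfulness of the copy). [folklore] -/
theorem newtonLeibnizRel_eq_iUnion : KZ.newtonLeibnizRel = ⋃ j, newtonLeibnizRelAt j := by
  ext c
  simp only [KZ.newtonLeibnizRel, newtonLeibnizRelAt, mem_setOf_eq, mem_iUnion]

theorem newtonLeibnizRelAt_subset (j : ℕ) : newtonLeibnizRelAt j ⊆ KZ.newtonLeibnizRel := by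
  rw [newtonLeibnizRel_eq_iUnion]; exact subset_iUnion _ j

/-- All moves except the Newton–Leibniz instances between dimensions `k` and `k - 1`… precisely:
the three same-dimension move sets and the Newton–Leibniz levels `j ≠ k`. [folklore] -/
def movesAvoidingLevel (k : ℕ) : Set KZ.FormalRep :=
  KZ.domainAddRel ∪ KZ.integrandAddRel ∪ KZ.changeOfVariablesRel ∪ ⋃ j ∈ {j : ℕ | j ≠ k}, newtonLeibnizRelAt j

/-- Adding the missing level recovers the full move set of `KZ.relations`. [folklore] -/
theorem movesAvoidingLevel_union (k : ℕ) :
    movesAvoidingLevel k ∪ newtonLeibnizRelAt k =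
      KZ.domainAddRel ∪ KZ.integrandAddRel ∪ KZ.changeOfVariablesRel ∪ KZ.newtonLeibnizRel := by
  rw [newtonLeibnizRel_eq_iUnion, movesAvoidingLevel]
  ext c
  simp only [mem_union, mem_iUnion, mem_setOf_eq, exists_prop]
  constructor
  · rintro ((((h | h) | h) | ⟨j, -, hj⟩) | h)
    · exact Or.inl (Or.inl (Or.inl h))
    · exact Or.inl (Or.inl (Or.inr h))
    · exact Or.inl (Or.inr h)
    · exact Or.inr ⟨j, hj⟩
    · exact Or.inr ⟨k, h⟩
  · rintro (((h | h) | h) | ⟨j, hj⟩)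
    · exact Or.inl (Or.inl (Or.inl (Or.inl h)))
    · exact Or.inl (Or.inl (Or.inl (Or.inr h)))
    · exact Or.inl (Or.inl (Or.inr h))
    · by_cases hjk : j = k
      · subst hjk; exact Or.inr hj
      · exact Or.inl (Or.inr ⟨j, hjk, hj⟩)

theorem closure_movesAvoidingLevel_le (k : ℕ) :
    AddSubgroup.closure (movesAvoidingLevel k) ≤ KZ.relations := by
  refine AddSubgroup.closure_mono ?_
  rw [← movesAvoidingLevel_union k]
  exact subset_union_left

/-- The graded evaluation `evalFrom (k+1)` kills every move avoiding the level `k`. [folklore] -/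
theorem evalFrom_eq_zero_of_mem {k : ℕ} {c : KZ.FormalRep} (hc : c ∈ movesAvoidingLevel k) :
    evalFrom (k + 1) c = 0 := by
  rcases hc with ((hc | hc) | hc) | hc
  · obtain ⟨n, r, r₁, r₂, hd, hv, h₁, h₂, rfl⟩ := hc
    have h0 : KZ.eval (KZ.of r - KZ.of r₁ - KZ.of r₂) = 0 :=
      KZ.eval_eq_zero_of_mem_domainAddRel_holds ⟨n, r, r₁, r₂, hd, hv, h₁, h₂, rfl⟩
    simp only [map_sub, KZ.eval_of] at h0
    simp only [map_sub, evalFrom_of]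
    split_ifs <;> simp [h0]
  · obtain ⟨n, r, r₁, r₂, hd₁, hd₂, hadd, rfl⟩ := hc
    have h0 : KZ.eval (KZ.of r - KZ.of r₁ - KZ.of r₂) = 0 :=
      KZ.eval_eq_zero_of_mem_integrandAddRel_holds ⟨n, r, r₁, r₂, hd₁, hd₂, hadd, rfl⟩
    simp only [map_sub, KZ.eval_of] at h0
    simp only [map_sub, evalFrom_of]
    split_ifs <;> simp [h0]
  · obtain ⟨n, r, r', Φ, Φ', hΦ, hΦ', hinj, hdom, hf, rfl⟩ := hc
    have h0 : KZ.eval (KZ.of r - KZ.of r') = 0 :=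
      KZ.eval_eq_zero_of_mem_changeOfVariablesRel_holds ⟨n, r, r', Φ, Φ', hΦ, hΦ', hinj, hdom, hf, rfl⟩
    simp only [map_sub, KZ.eval_of] at h0
    simp only [map_sub, evalFrom_of]
    split_ifs <;> simp [h0]
  · simp only [mem_iUnion, mem_setOf_eq, exists_prop] at hc
    obtain ⟨j, hjk, hc⟩ := hc
    have h0 : KZ.eval c = 0 :=
      KZ.eval_eq_zero_of_mem_newtonLeibnizRel_holds (newtonLeibnizRelAt_subset j hc)
    obtain ⟨r, r', a, b, F, -, -, -, -, -, -, -, -, rfl⟩ := hc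
    simp only [map_sub, KZ.eval_of] at h0
    simp only [map_sub, evalFrom_of]
    have hiff : (k + 1 ≤ j + 1) ↔ (k + 1 ≤ j) := by omega
    by_cases hle : k + 1 ≤ j
    · rw [if_pos (hiff.mpr hle), if_pos hle, h0]
    · rw [if_neg (mt hiff.mp hle), if_neg hle, sub_zero]

/-- `evalFrom (k+1)` vanishes on the subgroup generated by the moves avoiding level `k`. [folklore] -/
theorem evalFrom_eq_zero_of_mem_closure {k : ℕ} {c : KZ.FormalRep}
    (hc : c ∈ AddSubgroup.closure (movesAvoidingLevel k)) : evalFrom (k + 1) c = 0 := by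
  induction hc using AddSubgroup.closure_induction with
  | mem x hx => exact evalFrom_eq_zero_of_mem hx
  | zero => simp
  | add x y _ _ hx hy => simp [hx, hy]
  | neg x _ hx => simp [hx]

/-- **No chain avoids a Newton–Leibniz move `4 → 3`.** For every pair as in the crux,
`[r] − [r']` is NOT in the subgroup generated by domain/integrand additivity, change of variables and
the Newton–Leibniz moves of all levels other than `4 → 3`. (Refutes the strengthening of the crux to
that sub-calculus; `evalFrom 4` witnesses it, value `P(K₄) > 0`.) [folklore] -/
theorem not_mem_closure_movesAvoidingLevel_three (r : KZ.IntegralRep 5) (r' : KZ.IntegralRep 3)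
    (h1 : H1 r) (h2 : H2 r) :
    KZ.of r - KZ.of r' ∉ AddSubgroup.closure (movesAvoidingLevel 3) := by
  intro hmem
  have h := evalFrom_eq_zero_of_mem_closure hmem
  simp only [map_sub, evalFrom_of] at h
  norm_num at h
  exact (value_pos_left r h1 h2).ne' h

/-- **No chain avoids a Newton–Leibniz move `5 → 4`.** Same with the level `5 → 4`
(`evalFrom 5`). [folklore] -/
theorem not_mem_closure_movesAvoidingLevel_four (r : KZ.IntegralRep 5) (r' : KZ.IntegralRep 3)
    (h1 : H1 r) (h2 : H2 r) :
    KZ.of r - KZ.of r' ∉ AddSubgroup.closure (movesAvoidingLevel 4) := by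
  intro hmem
  have h := evalFrom_eq_zero_of_mem_closure hmem
  simp only [map_sub, evalFrom_of] at h
  norm_num at h
  exact (value_pos_left r h1 h2).ne' h

/-- The refuted strengthening, as a named statement: "the crux pair is connected inside the
sub-calculus avoiding the Newton–Leibniz level `4 → 3`". [folklore] -/
def WheelThreeSpokesAvoidingLevelThree : Prop :=
  ∀ (r : KZ.IntegralRep 5) (r' : KZ.IntegralRep 3), H1 r → H2 r → H3 r' → H4 r' →
    KZ.of r - KZ.of r' ∈ AddSubgroup.closure (movesAvoidingLevel 3)

/-- The refuted strengthening for the level `5 → 4`. [folklore] -/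
def WheelThreeSpokesAvoidingLevelFour : Prop :=
  ∀ (r : KZ.IntegralRep 5) (r' : KZ.IntegralRep 3), H1 r → H2 r → H3 r' → H4 r' →
    KZ.of r - KZ.of r' ∈ AddSubgroup.closure (movesAvoidingLevel 4)


/-! ## §2 Load-bearing hypotheses: witnesses -/

/-- The orthant is `ℚ`-semialgebraic. [folklore] -/
theorem isSemialgebraic_orthant : IsSemialgebraic ℚ orthant := by
  have : orthant = ⋂ i ∈ (Finset.univ : Finset (Fin 5)),
      {t : Fin 5 → ℝ | 0 < aeval t (X i : MvPolynomial (Fin 5) ℚ)} := by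
    ext t; simp [orthant]
  rw [this]
  exact IsSemialgebraic.biInter _ _ fun i _ => isSemialgebraic_setOf_eval_pos (k := ℚ) _

/-- The typed simplex is the library's `KZ.openOrderedSimplex 3`. [folklore] -/
theorem simplex3_eq_openOrderedSimplex : simplex3 = KZ.openOrderedSimplex 3 := by
  ext t
  simp only [simplex3, KZ.openOrderedSimplex, mem_setOf_eq]
  constructor
  · rintro ⟨h0, h01, h12, h2⟩
    refine ⟨?_, ?_, ?_⟩
    · intro i; fin_cases i <;> simp <;> linarith
    · intro i; fin_cases i <;> simp <;> linarith
    · rw [Fin.strictAnti_iff_succ_lt]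
      intro i; fin_cases i <;> simp <;> linarith
  · rintro ⟨hpos, hlt, hanti⟩
    exact ⟨hlt 0, hanti (by decide : (0 : Fin 3) < 1), hanti (by decide : (1 : Fin 3) < 2), hpos 2⟩

/-- The typed simplex is `ℚ`-semialgebraic. [folklore] -/
theorem isSemialgebraic_simplex3 : IsSemialgebraic ℚ simplex3 := by
  rw [simplex3_eq_openOrderedSimplex]; exact KZ.isSemialgebraic_openOrderedSimplex 3

/-- Any function is semialgebraic on the empty set. [folklore] -/
theorem isSemialgebraicFunOn_empty {n : ℕ} (f : (Fin n → ℝ) → ℝ) :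
    IsSemialgebraicFunOn ℚ (∅ : Set (Fin n → ℝ)) f := by
  unfold IsSemialgebraicFunOn
  convert (isSemialgebraic_empty : IsSemialgebraic ℚ (∅ : Set (Fin (n + 1) → ℝ)))
  ext z; simp

/-- The empty representation with a prescribed (irrelevant) integrand. [folklore] -/
def emptyRep (n : ℕ) (f : (Fin n → ℝ) → ℝ) : KZ.IntegralRep n :=
  ⟨∅, f, isSemialgebraic_empty, isSemialgebraicFunOn_empty f, integrableOn_empty⟩

@[simp] theorem value_emptyRep (n : ℕ) (f : (Fin n → ℝ) → ℝ) : (emptyRep n f).value = 0 := by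
  simp [KZ.IntegralRep.value, emptyRep]

/-- The zero representation on a semialgebraic domain. [folklore] -/
def zeroRep {n : ℕ} (σ : Set (Fin n → ℝ)) (hσ : IsSemialgebraic ℚ σ) : KZ.IntegralRep n :=
  ⟨σ, fun _ => 0, hσ, (isSemialgebraicFunOn_aeval hσ (0 : MvPolynomial (Fin n) ℚ)).congr
    (fun x _ => by simp), integrableOn_zero⟩

@[simp] theorem value_zeroRep {n : ℕ} (σ : Set (Fin n → ℝ)) (hσ : IsSemialgebraic ℚ σ) :
    (zeroRep σ hσ).value = 0 := by
  simp [KZ.IntegralRep.value, zeroRep]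

theorem mzvIntegrand_three (t : Fin 3 → ℝ) :
    KZ.mzvIntegrand [3] t = (1 / t 0) * (1 / t 1) * (1 / (1 - t 2)) := by
  show (∏ i : Fin 3, KZ.mzvForm ((MZV.binaryWord [3]).getD i false) (t i)) = _
  rw [Fin.prod_univ_three]
  simp [KZ.mzvForm, MZV.binaryWord]

theorem zeta3Integrand_eq (t : Fin 3 → ℝ) : zeta3Integrand t = 6 * KZ.mzvIntegrand [3] t := by
  rw [mzvIntegrand_three, zeta3Integrand, one_div, one_div, one_div, ← mul_inv, ← mul_inv,
    div_eq_mul_inv]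

/-- Absolute convergence of `6/(t₀t₁(1−t₂))` on the simplex, from the library fact for `ζ(3)`. [folklore] -/
theorem integrableOn_zeta3Integrand : IntegrableOn zeta3Integrand simplex3 volume := by
  have h : IntegrableOn (KZ.mzvIntegrand [3]) (KZ.openOrderedSimplex 3) volume :=
    KZ.mzvIntegrand_integrableOn_holds [3] (by decide)
  rw [simplex3_eq_openOrderedSimplex]
  have h6 : IntegrableOn (fun t => 6 * KZ.mzvIntegrand [3] t) (KZ.openOrderedSimplex 3) volume :=
    h.const_mul 6
  exact h6.congr_fun (fun t _ => (zeta3Integrand_eq t).symm) (KZ.measurableSet_openOrderedSimplex 3)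

/-- **The target representation exists**: `[1>t₀>t₁>t₂>0, 6/(t₀t₁(1−t₂))]` as a `KZ.IntegralRep 3`
(non-vacuity of the right-hand side of the crux). [folklore] -/
def zeta3Rep : KZ.IntegralRep 3 where
  domain := simplex3
  integrand := zeta3Integrand
  isSemialgebraic_domain := isSemialgebraic_simplex3
  isSemialgebraicFunOn_integrand := by
    refine (isSemialgebraicFunOn_aeval_div_aeval isSemialgebraic_simplex3 (6 : MvPolynomial (Fin 3) ℚ)
      (X 0 * X 1 * (1 - X 2)) ?_).congr ?_
    · rintro t ⟨h0, h01, h12, h2⟩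
      have : 0 < t 1 := by linarith
      have : 0 < t 0 := by linarith
      have : 0 < 1 - t 2 := by linarith
      simp only [map_mul, map_sub, map_one, aeval_X]
      positivity
    · intro t _
      simp [zeta3Integrand]
  integrableOn := integrableOn_zeta3Integrand

theorem zeta3Rep_H3 : H3 zeta3Rep := rfl
theorem zeta3Rep_H4 : H4 zeta3Rep := fun _ _ => rfl

theorem value_zeta3Rep_pos : 0 < zeta3Rep.value := value_pos_right _ zeta3Rep_H3 zeta3Rep_H4

/-- The value of ANY target representation is `6·ζ(3)` (library: Kontsevich's formula
`KZ.mzvRep_value_holds`). [folklore] -/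
theorem value_right_eq (r' : KZ.IntegralRep 3) (h3 : H3 r') (h4 : H4 r') :
    r'.value = 6 * multipleZeta [3] := by
  have hm : MeasurableSet r'.domain := KZ.IntegralRep.measurableSet_domain_holds r'
  have hv := KZ.mzvRep_value_holds [3] (by decide) (KZ.mzvIntegrand_isSemialgebraicFunOn_holds [3])
    (KZ.mzvIntegrand_integrableOn_holds [3] (by decide))
  rw [KZ.mzvRep_value_eq] at hv
  unfold KZ.IntegralRep.value
  rw [setIntegral_congr_fun hm h4, h3, simplex3_eq_openOrderedSimplex]
  change ∫ x in KZ.openOrderedSimplex 3, zeta3Integrand x = 6 * multipleZeta [3]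
  simp_rw [zeta3Integrand_eq]
  rw [integral_const_mul]
  exact congrArg (fun z => 6 * z) hv

/-- The crux with H1 dropped. [folklore] -/
def WheelThreeSpokesWithoutH1 : Prop :=
  ∀ (r : KZ.IntegralRep 5) (r' : KZ.IntegralRep 3), H2 r → H3 r' → H4 r' → KZ.Equivalent r r'
/-- The crux with H2 dropped. [folklore] -/
def WheelThreeSpokesWithoutH2 : Prop :=
  ∀ (r : KZ.IntegralRep 5) (r' : KZ.IntegralRep 3), H1 r → H3 r' → H4 r' → KZ.Equivalent r r'
/-- The crux with H3 dropped. [folklore] -/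
def WheelThreeSpokesWithoutH3 : Prop :=
  ∀ (r : KZ.IntegralRep 5) (r' : KZ.IntegralRep 3), H1 r → H2 r → H4 r' → KZ.Equivalent r r'
/-- The crux with H4 dropped. [folklore] -/
def WheelThreeSpokesWithoutH4 : Prop :=
  ∀ (r : KZ.IntegralRep 5) (r' : KZ.IntegralRep 3), H1 r → H2 r → H3 r' → KZ.Equivalent r r'

/-- **H1 is load-bearing**: witness `r = [∅, 1/Ψ²]` (value `0`), `r' = zeta3Rep` (value `> 0`),
separated by soundness `KZ.Equivalent.value_eq_holds`. [folklore] -/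
theorem wheelThreeSpokes_false_without_H1 : ¬ WheelThreeSpokesWithoutH1 := by
  intro h
  have heq := KZ.Equivalent.value_eq_holds
    (h (emptyRep 5 wheelIntegrand) zeta3Rep (fun _ _ => rfl) zeta3Rep_H3 zeta3Rep_H4)
  rw [value_emptyRep] at heq
  exact value_zeta3Rep_pos.ne heq

/-- **H2 is load-bearing**: witness `r = [ℝ₊⁵, 0]` (value `0`) against `zeta3Rep`. [folklore] -/
theorem wheelThreeSpokes_false_without_H2 : ¬ WheelThreeSpokesWithoutH2 := by
  intro h
  have heq := KZ.Equivalent.value_eq_holds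
    (h (zeroRep orthant isSemialgebraic_orthant) zeta3Rep rfl zeta3Rep_H3 zeta3Rep_H4)
  rw [value_zeroRep] at heq
  exact value_zeta3Rep_pos.ne heq

/-- **H3 is load-bearing** (modulo non-vacuity of the wheel side, i.e. absolute convergence of the
`K₄` period, a classical fact — primitive log-divergent graph): witness `r' = [∅, 6/(t₀t₁(1−t₂))]`. [folklore] -/
theorem wheelThreeSpokes_false_without_H3 (hW : ∃ r : KZ.IntegralRep 5, H1 r ∧ H2 r) :
    ¬ WheelThreeSpokesWithoutH3 := by
  intro h
  obtain ⟨r, h1, h2⟩ := hW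
  have heq := KZ.Equivalent.value_eq_holds (h r (emptyRep 3 zeta3Integrand) h1 h2 (fun _ _ => rfl))
  rw [value_emptyRep] at heq
  exact (value_pos_left r h1 h2).ne' heq

/-- **H4 is load-bearing** (modulo non-vacuity of the wheel side): witness `r' = [Δ₃, 0]`. [folklore] -/
theorem wheelThreeSpokes_false_without_H4 (hW : ∃ r : KZ.IntegralRep 5, H1 r ∧ H2 r) :
    ¬ WheelThreeSpokesWithoutH4 := by
  intro h
  obtain ⟨r, h1, h2⟩ := hW
  have heq := KZ.Equivalent.value_eq_holds (h r (zeroRep simplex3 isSemialgebraic_simplex3) h1 h2 rfl)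
  rw [value_zeroRep] at heq
  exact (value_pos_left r h1 h2).ne' heq

/-! ## §4 The crux is an instance of the summit, given the classical value; a kill is summit-strength -/

/-- `Ψ_{K₄}(x,1)` as a polynomial over `ℚ`. [folklore] -/
def psiPoly : MvPolynomial (Fin 5) ℚ :=
  X 0 * X 1 * X 3 + X 0 * X 1 * X 4 + X 0 * X 1 + X 0 * X 2 * X 3 + X 0 * X 2 * X 4 + X 0 * X 2 +
    X 0 * X 3 + X 0 * X 4 + X 1 * X 2 * X 3 + X 1 * X 2 * X 4 + X 1 * X 2 + X 1 * X 3 * X 4 + X 1 * X 4 +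
    X 2 * X 3 * X 4 + X 2 * X 3 + X 3 * X 4

@[simp] theorem aeval_psiPoly (x : Fin 5 → ℝ) : aeval x psiPoly = psi x := by
  simp [psiPoly, psi]

/-- The wheel representation has KZ's rational shape (`p = 1`, `q = Ψ²`). [folklore] -/
theorem isRational_left (r : KZ.IntegralRep 5) (h1 : H1 r) (h2 : H2 r) : r.IsRational := by
  refine ⟨1, psiPoly ^ 2, fun x hx => ?_, fun x hx => ?_⟩
  · rw [h1] at hx
    simpa using (psi_pos hx).ne'
  · rw [h2 hx]
    simp [wheelIntegrand]

/-- The target representation has KZ's rational shape (`p = 6`, `q = t₀t₁(1−t₂)`). [folklore] -/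
theorem isRational_right (r' : KZ.IntegralRep 3) (h3 : H3 r') (h4 : H4 r') : r'.IsRational := by
  refine ⟨6, X 0 * X 1 * (1 - X 2), fun t ht => ?_, fun t ht => ?_⟩
  · rw [h3] at ht
    obtain ⟨h0, h01, h12, h2⟩ := ht
    have : 0 < t 1 := by linarith
    have : 0 < t 0 := by linarith
    have : 0 < 1 - t 2 := by linarith
    simp only [map_mul, map_sub, map_one, aeval_X]
    positivity
  · rw [h4 ht]
    simp [zeta3Integrand]

/-- **The value identity `P(K₄) = 6ζ(3)`** in the crux's own terms (Broadhurst–Kreimer 1995;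
Bloch–Esnault–Kreimer 2006; Schnetz 2010 census `P₃`; NOT formalised). It is NECESSARY for the crux
(`valueIdentity_of_wheelThreeSpokes`, soundness) and, given it, the crux FOLLOWS from the summit
(`wheelThreeSpokes_of_summit`). Consequently a disproof of the crux is either a value mismatch (excluded:
the TYPED polynomial equals the Kirchhoff polynomial of `K₄` from its 16 spanning trees EXACTLY, and
`∫_{ℝ₊⁵} dx/Ψ² = 7.2123414247` vs `6ζ(3) = 7.2123414190`, rel. 8e-10 — evidence `numerics.txt`; the right
value is `6·multipleZeta [3]` by `value_right_eq`) or a disproof of `KontsevichZagierPeriods` itself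
(an additive invariant of `KZ.FormalRep` killing the four move sets and separating the pair; none is
known — route Neg, item NegObstructionShape). This is WHY THE CRUX RESISTS cheap refutation. [folklore] -/
def ValueIdentity : Prop :=
  ∀ (r : KZ.IntegralRep 5) (r' : KZ.IntegralRep 3), H1 r → H2 r → H3 r' → H4 r' → r.value = r'.value

/-- The value identity in closed form: `ValueIdentity ↔ ∀ wheel reps, value = 6·ζ(3)`. [folklore] -/
theorem valueIdentity_iff :
    ValueIdentity ↔ ∀ r : KZ.IntegralRep 5, H1 r → H2 r → r.value = 6 * multipleZeta [3] := by
  constructor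
  · intro h r h1 h2
    rw [← value_right_eq zeta3Rep zeta3Rep_H3 zeta3Rep_H4]
    exact h r zeta3Rep h1 h2 zeta3Rep_H3 zeta3Rep_H4
  · intro h r r' h1 h2 h3 h4
    rw [h r h1 h2, value_right_eq r' h3 h4]

/-- The value identity is necessary for the crux (soundness of the calculus). [folklore] -/
theorem valueIdentity_of_wheelThreeSpokes (h : WheelThreeSpokes) : ValueIdentity :=
  fun r r' h1 h2 h3 h4 => KZ.Equivalent.value_eq_holds (h r r' h1 h2 h3 h4)

/-- Given the value identity, the crux is an instance of the summit. [folklore] -/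
theorem wheelThreeSpokes_of_summit (hv : ValueIdentity) (hKZ : _root_.KontsevichZagierPeriods) :
    WheelThreeSpokes :=
  fun r r' h1 h2 h3 h4 =>
    hKZ r r' (isRational_left r h1 h2) (isRational_right r' h3 h4) (hv r r' h1 h2 h3 h4)

/-- **A kill of the crux is summit-strength**: given the classical value identity, `¬ WheelThreeSpokes`
refutes `KontsevichZagierPeriods`. [folklore] -/
theorem not_summit_of_not_wheelThreeSpokes (hv : ValueIdentity) (h : ¬ WheelThreeSpokes) :
    ¬ _root_.KontsevichZagierPeriods :=
  fun hKZ => h (wheelThreeSpokes_of_summit hv hKZ)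


/-! ## §6 NON-VACUITY: absolute convergence of the `K₄` period and the wheel representation -/

/-! ### The key polynomial inequality (generated; integer decomposition in the co-tree polytope of `K₄`)

With `x = a⁵`: every corner monomial `a^k`, `k ∈ {2,3}⁵` (the box `[2/5,3/5]⁵ ⊆ NP(Ψ)`, scaled by 5),
satisfies `(a^k)⁵ =` a product of five monomials of `Ψ(a⁵)`, hence `a^k ≤ Ψ(a⁵)`; summing the 32
corners, `∏ᵢ (aᵢ² + aᵢ³) ≤ 32 · Ψ(a⁵)`. -/

/-- Five factors each `≤ P` have product `≤ P⁵`. [folklore] -/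
theorem prod5_le {m1 m2 m3 m4 m5 P : ℝ} (h1 : m1 ≤ P) (h2 : m2 ≤ P) (h3 : m3 ≤ P) (h4 : m4 ≤ P)
    (h5 : m5 ≤ P) (n1 : 0 ≤ m1) (n2 : 0 ≤ m2) (n3 : 0 ≤ m3) (n4 : 0 ≤ m4) (n5 : 0 ≤ m5) :
    m1 * m2 * m3 * m4 * m5 ≤ P ^ 5 := by
  have hP : 0 ≤ P := n1.trans h1
  have e2 : m1 * m2 ≤ P * P := mul_le_mul h1 h2 n2 hP
  have e3 : m1 * m2 * m3 ≤ P * P * P := mul_le_mul e2 h3 n3 (mul_nonneg hP hP)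
  have e4 : m1 * m2 * m3 * m4 ≤ P * P * P * P :=
    mul_le_mul e3 h4 n4 (mul_nonneg (mul_nonneg hP hP) hP)
  have e5 : m1 * m2 * m3 * m4 * m5 ≤ P * P * P * P * P :=
    mul_le_mul e4 h5 n5 (mul_nonneg (mul_nonneg (mul_nonneg hP hP) hP) hP)
  calc m1 * m2 * m3 * m4 * m5 ≤ P * P * P * P * P := e5
    _ = P ^ 5 := by ring

/-- `Ψ(a⁵)`. [folklore] -/
def P5 (a : Fin 5 → ℝ) : ℝ := psi (fun i => a i ^ 5)

theorem P5_eq (a : Fin 5 → ℝ) : P5 a =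
      a 0 ^ 5 * a 1 ^ 5 * a 3 ^ 5 + a 0 ^ 5 * a 1 ^ 5 * a 4 ^ 5 + a 0 ^ 5 * a 1 ^ 5 + a 0 ^ 5 * a 2 ^ 5 * a 3 ^ 5 +
      a 0 ^ 5 * a 2 ^ 5 * a 4 ^ 5 + a 0 ^ 5 * a 2 ^ 5 + a 0 ^ 5 * a 3 ^ 5 + a 0 ^ 5 * a 4 ^ 5 +
      a 1 ^ 5 * a 2 ^ 5 * a 3 ^ 5 + a 1 ^ 5 * a 2 ^ 5 * a 4 ^ 5 + a 1 ^ 5 * a 2 ^ 5 + a 1 ^ 5 * a 3 ^ 5 * a 4 ^ 5 +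
      a 1 ^ 5 * a 4 ^ 5 + a 2 ^ 5 * a 3 ^ 5 * a 4 ^ 5 + a 2 ^ 5 * a 3 ^ 5 + a 3 ^ 5 * a 4 ^ 5 := rfl

section corners
variable (a : Fin 5 → ℝ) (h0 : 0 < a 0) (h1 : 0 < a 1) (h2 : 0 < a 2) (h3 : 0 < a 3) (h4 : 0 < a 4)
include h0 h1 h2 h3 h4

theorem P5_nonneg : 0 ≤ P5 a := by rw [P5_eq]; positivity

theorem b013 : a 0 ^ 5 * a 1 ^ 5 * a 3 ^ 5 ≤ P5 a := by
  have h : P5 a - (a 0 ^ 5 * a 1 ^ 5 * a 3 ^ 5) =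
      a 0 ^ 5 * a 1 ^ 5 * a 4 ^ 5 + a 0 ^ 5 * a 1 ^ 5 + a 0 ^ 5 * a 2 ^ 5 * a 3 ^ 5 + a 0 ^ 5 * a 2 ^ 5 * a 4 ^ 5 + a 0 ^ 5 * a 2 ^ 5 + a 0 ^ 5 * a 3 ^ 5 + a 0 ^ 5 * a 4 ^ 5 + a 1 ^ 5 * a 2 ^ 5 * a 3 ^ 5 + a 1 ^ 5 * a 2 ^ 5 * a 4 ^ 5 + a 1 ^ 5 * a 2 ^ 5 + a 1 ^ 5 * a 3 ^ 5 * a 4 ^ 5 + a 1 ^ 5 * a 4 ^ 5 + a 2 ^ 5 * a 3 ^ 5 * a 4 ^ 5 + a 2 ^ 5 * a 3 ^ 5 + a 3 ^ 5 * a 4 ^ 5 := by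
    rw [P5_eq]; ring
  exact sub_nonneg.mp (h ▸ by positivity)

theorem b014 : a 0 ^ 5 * a 1 ^ 5 * a 4 ^ 5 ≤ P5 a := by
  have h : P5 a - (a 0 ^ 5 * a 1 ^ 5 * a 4 ^ 5) =
      a 0 ^ 5 * a 1 ^ 5 * a 3 ^ 5 + a 0 ^ 5 * a 1 ^ 5 + a 0 ^ 5 * a 2 ^ 5 * a 3 ^ 5 + a 0 ^ 5 * a 2 ^ 5 * a 4 ^ 5 + a 0 ^ 5 * a 2 ^ 5 + a 0 ^ 5 * a 3 ^ 5 + a 0 ^ 5 * a 4 ^ 5 + a 1 ^ 5 * a 2 ^ 5 * a 3 ^ 5 + a 1 ^ 5 * a 2 ^ 5 * a 4 ^ 5 + a 1 ^ 5 * a 2 ^ 5 + a 1 ^ 5 * a 3 ^ 5 * a 4 ^ 5 + a 1 ^ 5 * a 4 ^ 5 + a 2 ^ 5 * a 3 ^ 5 * a 4 ^ 5 + a 2 ^ 5 * a 3 ^ 5 + a 3 ^ 5 * a 4 ^ 5 := by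
    rw [P5_eq]; ring
  exact sub_nonneg.mp (h ▸ by positivity)

theorem b01 : a 0 ^ 5 * a 1 ^ 5 ≤ P5 a := by
  have h : P5 a - (a 0 ^ 5 * a 1 ^ 5) =
      a 0 ^ 5 * a 1 ^ 5 * a 3 ^ 5 + a 0 ^ 5 * a 1 ^ 5 * a 4 ^ 5 + a 0 ^ 5 * a 2 ^ 5 * a 3 ^ 5 + a 0 ^ 5 * a 2 ^ 5 * a 4 ^ 5 + a 0 ^ 5 * a 2 ^ 5 + a 0 ^ 5 * a 3 ^ 5 + a 0 ^ 5 * a 4 ^ 5 + a 1 ^ 5 * a 2 ^ 5 * a 3 ^ 5 + a 1 ^ 5 * a 2 ^ 5 * a 4 ^ 5 + a 1 ^ 5 * a 2 ^ 5 + a 1 ^ 5 * a 3 ^ 5 * a 4 ^ 5 + a 1 ^ 5 * a 4 ^ 5 + a 2 ^ 5 * a 3 ^ 5 * a 4 ^ 5 + a 2 ^ 5 * a 3 ^ 5 + a 3 ^ 5 * a 4 ^ 5 := by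
    rw [P5_eq]; ring
  exact sub_nonneg.mp (h ▸ by positivity)

theorem b023 : a 0 ^ 5 * a 2 ^ 5 * a 3 ^ 5 ≤ P5 a := by
  have h : P5 a - (a 0 ^ 5 * a 2 ^ 5 * a 3 ^ 5) =
      a 0 ^ 5 * a 1 ^ 5 * a 3 ^ 5 + a 0 ^ 5 * a 1 ^ 5 * a 4 ^ 5 + a 0 ^ 5 * a 1 ^ 5 + a 0 ^ 5 * a 2 ^ 5 * a 4 ^ 5 + a 0 ^ 5 * a 2 ^ 5 + a 0 ^ 5 * a 3 ^ 5 + a 0 ^ 5 * a 4 ^ 5 + a 1 ^ 5 * a 2 ^ 5 * a 3 ^ 5 + a 1 ^ 5 * a 2 ^ 5 * a 4 ^ 5 + a 1 ^ 5 * a 2 ^ 5 + a 1 ^ 5 * a 3 ^ 5 * a 4 ^ 5 + a 1 ^ 5 * a 4 ^ 5 + a 2 ^ 5 * a 3 ^ 5 * a 4 ^ 5 + a 2 ^ 5 * a 3 ^ 5 + a 3 ^ 5 * a 4 ^ 5 := by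
    rw [P5_eq]; ring
  exact sub_nonneg.mp (h ▸ by positivity)

theorem b024 : a 0 ^ 5 * a 2 ^ 5 * a 4 ^ 5 ≤ P5 a := by
  have h : P5 a - (a 0 ^ 5 * a 2 ^ 5 * a 4 ^ 5) =
      a 0 ^ 5 * a 1 ^ 5 * a 3 ^ 5 + a 0 ^ 5 * a 1 ^ 5 * a 4 ^ 5 + a 0 ^ 5 * a 1 ^ 5 + a 0 ^ 5 * a 2 ^ 5 * a 3 ^ 5 + a 0 ^ 5 * a 2 ^ 5 + a 0 ^ 5 * a 3 ^ 5 + a 0 ^ 5 * a 4 ^ 5 + a 1 ^ 5 * a 2 ^ 5 * a 3 ^ 5 + a 1 ^ 5 * a 2 ^ 5 * a 4 ^ 5 + a 1 ^ 5 * a 2 ^ 5 + a 1 ^ 5 * a 3 ^ 5 * a 4 ^ 5 + a 1 ^ 5 * a 4 ^ 5 + a 2 ^ 5 * a 3 ^ 5 * a 4 ^ 5 + a 2 ^ 5 * a 3 ^ 5 + a 3 ^ 5 * a 4 ^ 5 := by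
    rw [P5_eq]; ring
  exact sub_nonneg.mp (h ▸ by positivity)

theorem b02 : a 0 ^ 5 * a 2 ^ 5 ≤ P5 a := by
  have h : P5 a - (a 0 ^ 5 * a 2 ^ 5) =
      a 0 ^ 5 * a 1 ^ 5 * a 3 ^ 5 + a 0 ^ 5 * a 1 ^ 5 * a 4 ^ 5 + a 0 ^ 5 * a 1 ^ 5 + a 0 ^ 5 * a 2 ^ 5 * a 3 ^ 5 + a 0 ^ 5 * a 2 ^ 5 * a 4 ^ 5 + a 0 ^ 5 * a 3 ^ 5 + a 0 ^ 5 * a 4 ^ 5 + a 1 ^ 5 * a 2 ^ 5 * a 3 ^ 5 + a 1 ^ 5 * a 2 ^ 5 * a 4 ^ 5 + a 1 ^ 5 * a 2 ^ 5 + a 1 ^ 5 * a 3 ^ 5 * a 4 ^ 5 + a 1 ^ 5 * a 4 ^ 5 + a 2 ^ 5 * a 3 ^ 5 * a 4 ^ 5 + a 2 ^ 5 * a 3 ^ 5 + a 3 ^ 5 * a 4 ^ 5 := by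
    rw [P5_eq]; ring
  exact sub_nonneg.mp (h ▸ by positivity)

theorem b03 : a 0 ^ 5 * a 3 ^ 5 ≤ P5 a := by
  have h : P5 a - (a 0 ^ 5 * a 3 ^ 5) =
      a 0 ^ 5 * a 1 ^ 5 * a 3 ^ 5 + a 0 ^ 5 * a 1 ^ 5 * a 4 ^ 5 + a 0 ^ 5 * a 1 ^ 5 + a 0 ^ 5 * a 2 ^ 5 * a 3 ^ 5 + a 0 ^ 5 * a 2 ^ 5 * a 4 ^ 5 + a 0 ^ 5 * a 2 ^ 5 + a 0 ^ 5 * a 4 ^ 5 + a 1 ^ 5 * a 2 ^ 5 * a 3 ^ 5 + a 1 ^ 5 * a 2 ^ 5 * a 4 ^ 5 + a 1 ^ 5 * a 2 ^ 5 + a 1 ^ 5 * a 3 ^ 5 * a 4 ^ 5 + a 1 ^ 5 * a 4 ^ 5 + a 2 ^ 5 * a 3 ^ 5 * a 4 ^ 5 + a 2 ^ 5 * a 3 ^ 5 + a 3 ^ 5 * a 4 ^ 5 := by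
    rw [P5_eq]; ring
  exact sub_nonneg.mp (h ▸ by positivity)

theorem b04 : a 0 ^ 5 * a 4 ^ 5 ≤ P5 a := by
  have h : P5 a - (a 0 ^ 5 * a 4 ^ 5) =
      a 0 ^ 5 * a 1 ^ 5 * a 3 ^ 5 + a 0 ^ 5 * a 1 ^ 5 * a 4 ^ 5 + a 0 ^ 5 * a 1 ^ 5 + a 0 ^ 5 * a 2 ^ 5 * a 3 ^ 5 + a 0 ^ 5 * a 2 ^ 5 * a 4 ^ 5 + a 0 ^ 5 * a 2 ^ 5 + a 0 ^ 5 * a 3 ^ 5 + a 1 ^ 5 * a 2 ^ 5 * a 3 ^ 5 + a 1 ^ 5 * a 2 ^ 5 * a 4 ^ 5 + a 1 ^ 5 * a 2 ^ 5 + a 1 ^ 5 * a 3 ^ 5 * a 4 ^ 5 + a 1 ^ 5 * a 4 ^ 5 + a 2 ^ 5 * a 3 ^ 5 * a 4 ^ 5 + a 2 ^ 5 * a 3 ^ 5 + a 3 ^ 5 * a 4 ^ 5 := by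
    rw [P5_eq]; ring
  exact sub_nonneg.mp (h ▸ by positivity)

theorem b123 : a 1 ^ 5 * a 2 ^ 5 * a 3 ^ 5 ≤ P5 a := by
  have h : P5 a - (a 1 ^ 5 * a 2 ^ 5 * a 3 ^ 5) =
      a 0 ^ 5 * a 1 ^ 5 * a 3 ^ 5 + a 0 ^ 5 * a 1 ^ 5 * a 4 ^ 5 + a 0 ^ 5 * a 1 ^ 5 + a 0 ^ 5 * a 2 ^ 5 * a 3 ^ 5 + a 0 ^ 5 * a 2 ^ 5 * a 4 ^ 5 + a 0 ^ 5 * a 2 ^ 5 + a 0 ^ 5 * a 3 ^ 5 + a 0 ^ 5 * a 4 ^ 5 + a 1 ^ 5 * a 2 ^ 5 * a 4 ^ 5 + a 1 ^ 5 * a 2 ^ 5 + a 1 ^ 5 * a 3 ^ 5 * a 4 ^ 5 + a 1 ^ 5 * a 4 ^ 5 + a 2 ^ 5 * a 3 ^ 5 * a 4 ^ 5 + a 2 ^ 5 * a 3 ^ 5 + a 3 ^ 5 * a 4 ^ 5 := by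
    rw [P5_eq]; ring
  exact sub_nonneg.mp (h ▸ by positivity)

theorem b124 : a 1 ^ 5 * a 2 ^ 5 * a 4 ^ 5 ≤ P5 a := by
  have h : P5 a - (a 1 ^ 5 * a 2 ^ 5 * a 4 ^ 5) =
      a 0 ^ 5 * a 1 ^ 5 * a 3 ^ 5 + a 0 ^ 5 * a 1 ^ 5 * a 4 ^ 5 + a 0 ^ 5 * a 1 ^ 5 + a 0 ^ 5 * a 2 ^ 5 * a 3 ^ 5 + a 0 ^ 5 * a 2 ^ 5 * a 4 ^ 5 + a 0 ^ 5 * a 2 ^ 5 + a 0 ^ 5 * a 3 ^ 5 + a 0 ^ 5 * a 4 ^ 5 + a 1 ^ 5 * a 2 ^ 5 * a 3 ^ 5 + a 1 ^ 5 * a 2 ^ 5 + a 1 ^ 5 * a 3 ^ 5 * a 4 ^ 5 + a 1 ^ 5 * a 4 ^ 5 + a 2 ^ 5 * a 3 ^ 5 * a 4 ^ 5 + a 2 ^ 5 * a 3 ^ 5 + a 3 ^ 5 * a 4 ^ 5 := by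
    rw [P5_eq]; ring
  exact sub_nonneg.mp (h ▸ by positivity)

theorem b12 : a 1 ^ 5 * a 2 ^ 5 ≤ P5 a := by
  have h : P5 a - (a 1 ^ 5 * a 2 ^ 5) =
      a 0 ^ 5 * a 1 ^ 5 * a 3 ^ 5 + a 0 ^ 5 * a 1 ^ 5 * a 4 ^ 5 + a 0 ^ 5 * a 1 ^ 5 + a 0 ^ 5 * a 2 ^ 5 * a 3 ^ 5 + a 0 ^ 5 * a 2 ^ 5 * a 4 ^ 5 + a 0 ^ 5 * a 2 ^ 5 + a 0 ^ 5 * a 3 ^ 5 + a 0 ^ 5 * a 4 ^ 5 + a 1 ^ 5 * a 2 ^ 5 * a 3 ^ 5 + a 1 ^ 5 * a 2 ^ 5 * a 4 ^ 5 + a 1 ^ 5 * a 3 ^ 5 * a 4 ^ 5 + a 1 ^ 5 * a 4 ^ 5 + a 2 ^ 5 * a 3 ^ 5 * a 4 ^ 5 + a 2 ^ 5 * a 3 ^ 5 + a 3 ^ 5 * a 4 ^ 5 := by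
    rw [P5_eq]; ring
  exact sub_nonneg.mp (h ▸ by positivity)

theorem b134 : a 1 ^ 5 * a 3 ^ 5 * a 4 ^ 5 ≤ P5 a := by
  have h : P5 a - (a 1 ^ 5 * a 3 ^ 5 * a 4 ^ 5) =
      a 0 ^ 5 * a 1 ^ 5 * a 3 ^ 5 + a 0 ^ 5 * a 1 ^ 5 * a 4 ^ 5 + a 0 ^ 5 * a 1 ^ 5 + a 0 ^ 5 * a 2 ^ 5 * a 3 ^ 5 + a 0 ^ 5 * a 2 ^ 5 * a 4 ^ 5 + a 0 ^ 5 * a 2 ^ 5 + a 0 ^ 5 * a 3 ^ 5 + a 0 ^ 5 * a 4 ^ 5 + a 1 ^ 5 * a 2 ^ 5 * a 3 ^ 5 + a 1 ^ 5 * a 2 ^ 5 * a 4 ^ 5 + a 1 ^ 5 * a 2 ^ 5 + a 1 ^ 5 * a 4 ^ 5 + a 2 ^ 5 * a 3 ^ 5 * a 4 ^ 5 + a 2 ^ 5 * a 3 ^ 5 + a 3 ^ 5 * a 4 ^ 5 := by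
    rw [P5_eq]; ring
  exact sub_nonneg.mp (h ▸ by positivity)

theorem b14 : a 1 ^ 5 * a 4 ^ 5 ≤ P5 a := by
  have h : P5 a - (a 1 ^ 5 * a 4 ^ 5) =
      a 0 ^ 5 * a 1 ^ 5 * a 3 ^ 5 + a 0 ^ 5 * a 1 ^ 5 * a 4 ^ 5 + a 0 ^ 5 * a 1 ^ 5 + a 0 ^ 5 * a 2 ^ 5 * a 3 ^ 5 + a 0 ^ 5 * a 2 ^ 5 * a 4 ^ 5 + a 0 ^ 5 * a 2 ^ 5 + a 0 ^ 5 * a 3 ^ 5 + a 0 ^ 5 * a 4 ^ 5 + a 1 ^ 5 * a 2 ^ 5 * a 3 ^ 5 + a 1 ^ 5 * a 2 ^ 5 * a 4 ^ 5 + a 1 ^ 5 * a 2 ^ 5 + a 1 ^ 5 * a 3 ^ 5 * a 4 ^ 5 + a 2 ^ 5 * a 3 ^ 5 * a 4 ^ 5 + a 2 ^ 5 * a 3 ^ 5 + a 3 ^ 5 * a 4 ^ 5 := by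
    rw [P5_eq]; ring
  exact sub_nonneg.mp (h ▸ by positivity)

theorem b234 : a 2 ^ 5 * a 3 ^ 5 * a 4 ^ 5 ≤ P5 a := by
  have h : P5 a - (a 2 ^ 5 * a 3 ^ 5 * a 4 ^ 5) =
      a 0 ^ 5 * a 1 ^ 5 * a 3 ^ 5 + a 0 ^ 5 * a 1 ^ 5 * a 4 ^ 5 + a 0 ^ 5 * a 1 ^ 5 + a 0 ^ 5 * a 2 ^ 5 * a 3 ^ 5 + a 0 ^ 5 * a 2 ^ 5 * a 4 ^ 5 + a 0 ^ 5 * a 2 ^ 5 + a 0 ^ 5 * a 3 ^ 5 + a 0 ^ 5 * a 4 ^ 5 + a 1 ^ 5 * a 2 ^ 5 * a 3 ^ 5 + a 1 ^ 5 * a 2 ^ 5 * a 4 ^ 5 + a 1 ^ 5 * a 2 ^ 5 + a 1 ^ 5 * a 3 ^ 5 * a 4 ^ 5 + a 1 ^ 5 * a 4 ^ 5 + a 2 ^ 5 * a 3 ^ 5 + a 3 ^ 5 * a 4 ^ 5 := by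
    rw [P5_eq]; ring
  exact sub_nonneg.mp (h ▸ by positivity)

theorem b23 : a 2 ^ 5 * a 3 ^ 5 ≤ P5 a := by
  have h : P5 a - (a 2 ^ 5 * a 3 ^ 5) =
      a 0 ^ 5 * a 1 ^ 5 * a 3 ^ 5 + a 0 ^ 5 * a 1 ^ 5 * a 4 ^ 5 + a 0 ^ 5 * a 1 ^ 5 + a 0 ^ 5 * a 2 ^ 5 * a 3 ^ 5 + a 0 ^ 5 * a 2 ^ 5 * a 4 ^ 5 + a 0 ^ 5 * a 2 ^ 5 + a 0 ^ 5 * a 3 ^ 5 + a 0 ^ 5 * a 4 ^ 5 + a 1 ^ 5 * a 2 ^ 5 * a 3 ^ 5 + a 1 ^ 5 * a 2 ^ 5 * a 4 ^ 5 + a 1 ^ 5 * a 2 ^ 5 + a 1 ^ 5 * a 3 ^ 5 * a 4 ^ 5 + a 1 ^ 5 * a 4 ^ 5 + a 2 ^ 5 * a 3 ^ 5 * a 4 ^ 5 + a 3 ^ 5 * a 4 ^ 5 := by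
    rw [P5_eq]; ring
  exact sub_nonneg.mp (h ▸ by positivity)

theorem b34 : a 3 ^ 5 * a 4 ^ 5 ≤ P5 a := by
  have h : P5 a - (a 3 ^ 5 * a 4 ^ 5) =
      a 0 ^ 5 * a 1 ^ 5 * a 3 ^ 5 + a 0 ^ 5 * a 1 ^ 5 * a 4 ^ 5 + a 0 ^ 5 * a 1 ^ 5 + a 0 ^ 5 * a 2 ^ 5 * a 3 ^ 5 + a 0 ^ 5 * a 2 ^ 5 * a 4 ^ 5 + a 0 ^ 5 * a 2 ^ 5 + a 0 ^ 5 * a 3 ^ 5 + a 0 ^ 5 * a 4 ^ 5 + a 1 ^ 5 * a 2 ^ 5 * a 3 ^ 5 + a 1 ^ 5 * a 2 ^ 5 * a 4 ^ 5 + a 1 ^ 5 * a 2 ^ 5 + a 1 ^ 5 * a 3 ^ 5 * a 4 ^ 5 + a 1 ^ 5 * a 4 ^ 5 + a 2 ^ 5 * a 3 ^ 5 * a 4 ^ 5 + a 2 ^ 5 * a 3 ^ 5 := by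
    rw [P5_eq]; ring
  exact sub_nonneg.mp (h ▸ by positivity)

theorem c22222 : a 0 ^ 2 * a 1 ^ 2 * a 2 ^ 2 * a 3 ^ 2 * a 4 ^ 2 ≤ P5 a := by
  refine le_of_pow_le_pow_left₀ (by norm_num : (5 : ℕ) ≠ 0) (P5_nonneg a h0 h1 h2 h3 h4) ?_
  calc (a 0 ^ 2 * a 1 ^ 2 * a 2 ^ 2 * a 3 ^ 2 * a 4 ^ 2) ^ 5
      = (a 0 ^ 5 * a 1 ^ 5) * (a 0 ^ 5 * a 2 ^ 5) * (a 1 ^ 5 * a 2 ^ 5) * (a 3 ^ 5 * a 4 ^ 5) * (a 3 ^ 5 * a 4 ^ 5) := by ring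
    _ ≤ P5 a ^ 5 := prod5_le (b01 a h0 h1 h2 h3 h4) (b02 a h0 h1 h2 h3 h4) (b12 a h0 h1 h2 h3 h4) (b34 a h0 h1 h2 h3 h4) (b34 a h0 h1 h2 h3 h4)
        (by positivity) (by positivity) (by positivity) (by positivity) (by positivity)

theorem c22223 : a 0 ^ 2 * a 1 ^ 2 * a 2 ^ 2 * a 3 ^ 2 * a 4 ^ 3 ≤ P5 a := by
  refine le_of_pow_le_pow_left₀ (by norm_num : (5 : ℕ) ≠ 0) (P5_nonneg a h0 h1 h2 h3 h4) ?_
  calc (a 0 ^ 2 * a 1 ^ 2 * a 2 ^ 2 * a 3 ^ 2 * a 4 ^ 3) ^ 5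
      = (a 0 ^ 5 * a 1 ^ 5 * a 4 ^ 5) * (a 0 ^ 5 * a 2 ^ 5) * (a 1 ^ 5 * a 2 ^ 5) * (a 3 ^ 5 * a 4 ^ 5) * (a 3 ^ 5 * a 4 ^ 5) := by ring
    _ ≤ P5 a ^ 5 := prod5_le (b014 a h0 h1 h2 h3 h4) (b02 a h0 h1 h2 h3 h4) (b12 a h0 h1 h2 h3 h4) (b34 a h0 h1 h2 h3 h4) (b34 a h0 h1 h2 h3 h4)
        (by positivity) (by positivity) (by positivity) (by positivity) (by positivity)

theorem c22232 : a 0 ^ 2 * a 1 ^ 2 * a 2 ^ 2 * a 3 ^ 3 * a 4 ^ 2 ≤ P5 a := by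
  refine le_of_pow_le_pow_left₀ (by norm_num : (5 : ℕ) ≠ 0) (P5_nonneg a h0 h1 h2 h3 h4) ?_
  calc (a 0 ^ 2 * a 1 ^ 2 * a 2 ^ 2 * a 3 ^ 3 * a 4 ^ 2) ^ 5
      = (a 0 ^ 5 * a 1 ^ 5 * a 3 ^ 5) * (a 0 ^ 5 * a 2 ^ 5) * (a 1 ^ 5 * a 2 ^ 5) * (a 3 ^ 5 * a 4 ^ 5) * (a 3 ^ 5 * a 4 ^ 5) := by ring
    _ ≤ P5 a ^ 5 := prod5_le (b013 a h0 h1 h2 h3 h4) (b02 a h0 h1 h2 h3 h4) (b12 a h0 h1 h2 h3 h4) (b34 a h0 h1 h2 h3 h4) (b34 a h0 h1 h2 h3 h4)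
        (by positivity) (by positivity) (by positivity) (by positivity) (by positivity)

theorem c22233 : a 0 ^ 2 * a 1 ^ 2 * a 2 ^ 2 * a 3 ^ 3 * a 4 ^ 3 ≤ P5 a := by
  refine le_of_pow_le_pow_left₀ (by norm_num : (5 : ℕ) ≠ 0) (P5_nonneg a h0 h1 h2 h3 h4) ?_
  calc (a 0 ^ 2 * a 1 ^ 2 * a 2 ^ 2 * a 3 ^ 3 * a 4 ^ 3) ^ 5
      = (a 0 ^ 5 * a 1 ^ 5 * a 3 ^ 5) * (a 0 ^ 5 * a 2 ^ 5 * a 4 ^ 5) * (a 1 ^ 5 * a 2 ^ 5) * (a 3 ^ 5 * a 4 ^ 5) * (a 3 ^ 5 * a 4 ^ 5) := by ring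
    _ ≤ P5 a ^ 5 := prod5_le (b013 a h0 h1 h2 h3 h4) (b024 a h0 h1 h2 h3 h4) (b12 a h0 h1 h2 h3 h4) (b34 a h0 h1 h2 h3 h4) (b34 a h0 h1 h2 h3 h4)
        (by positivity) (by positivity) (by positivity) (by positivity) (by positivity)

theorem c22322 : a 0 ^ 2 * a 1 ^ 2 * a 2 ^ 3 * a 3 ^ 2 * a 4 ^ 2 ≤ P5 a := by
  refine le_of_pow_le_pow_left₀ (by norm_num : (5 : ℕ) ≠ 0) (P5_nonneg a h0 h1 h2 h3 h4) ?_
  calc (a 0 ^ 2 * a 1 ^ 2 * a 2 ^ 3 * a 3 ^ 2 * a 4 ^ 2) ^ 5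
      = (a 0 ^ 5 * a 1 ^ 5 * a 4 ^ 5) * (a 0 ^ 5 * a 2 ^ 5) * (a 1 ^ 5 * a 2 ^ 5) * (a 2 ^ 5 * a 3 ^ 5) * (a 3 ^ 5 * a 4 ^ 5) := by ring
    _ ≤ P5 a ^ 5 := prod5_le (b014 a h0 h1 h2 h3 h4) (b02 a h0 h1 h2 h3 h4) (b12 a h0 h1 h2 h3 h4) (b23 a h0 h1 h2 h3 h4) (b34 a h0 h1 h2 h3 h4)
        (by positivity) (by positivity) (by positivity) (by positivity) (by positivity)

theorem c22323 : a 0 ^ 2 * a 1 ^ 2 * a 2 ^ 3 * a 3 ^ 2 * a 4 ^ 3 ≤ P5 a := by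
  refine le_of_pow_le_pow_left₀ (by norm_num : (5 : ℕ) ≠ 0) (P5_nonneg a h0 h1 h2 h3 h4) ?_
  calc (a 0 ^ 2 * a 1 ^ 2 * a 2 ^ 3 * a 3 ^ 2 * a 4 ^ 3) ^ 5
      = (a 0 ^ 5 * a 1 ^ 5 * a 4 ^ 5) * (a 0 ^ 5 * a 2 ^ 5 * a 4 ^ 5) * (a 1 ^ 5 * a 2 ^ 5) * (a 2 ^ 5 * a 3 ^ 5) * (a 3 ^ 5 * a 4 ^ 5) := by ring
    _ ≤ P5 a ^ 5 := prod5_le (b014 a h0 h1 h2 h3 h4) (b024 a h0 h1 h2 h3 h4) (b12 a h0 h1 h2 h3 h4) (b23 a h0 h1 h2 h3 h4) (b34 a h0 h1 h2 h3 h4)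
        (by positivity) (by positivity) (by positivity) (by positivity) (by positivity)

theorem c22332 : a 0 ^ 2 * a 1 ^ 2 * a 2 ^ 3 * a 3 ^ 3 * a 4 ^ 2 ≤ P5 a := by
  refine le_of_pow_le_pow_left₀ (by norm_num : (5 : ℕ) ≠ 0) (P5_nonneg a h0 h1 h2 h3 h4) ?_
  calc (a 0 ^ 2 * a 1 ^ 2 * a 2 ^ 3 * a 3 ^ 3 * a 4 ^ 2) ^ 5
      = (a 0 ^ 5 * a 1 ^ 5 * a 3 ^ 5) * (a 0 ^ 5 * a 2 ^ 5 * a 4 ^ 5) * (a 1 ^ 5 * a 2 ^ 5) * (a 2 ^ 5 * a 3 ^ 5) * (a 3 ^ 5 * a 4 ^ 5) := by ring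
    _ ≤ P5 a ^ 5 := prod5_le (b013 a h0 h1 h2 h3 h4) (b024 a h0 h1 h2 h3 h4) (b12 a h0 h1 h2 h3 h4) (b23 a h0 h1 h2 h3 h4) (b34 a h0 h1 h2 h3 h4)
        (by positivity) (by positivity) (by positivity) (by positivity) (by positivity)

theorem c22333 : a 0 ^ 2 * a 1 ^ 2 * a 2 ^ 3 * a 3 ^ 3 * a 4 ^ 3 ≤ P5 a := by
  refine le_of_pow_le_pow_left₀ (by norm_num : (5 : ℕ) ≠ 0) (P5_nonneg a h0 h1 h2 h3 h4) ?_
  calc (a 0 ^ 2 * a 1 ^ 2 * a 2 ^ 3 * a 3 ^ 3 * a 4 ^ 3) ^ 5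
      = (a 0 ^ 5 * a 1 ^ 5 * a 3 ^ 5) * (a 0 ^ 5 * a 2 ^ 5 * a 4 ^ 5) * (a 1 ^ 5 * a 2 ^ 5 * a 4 ^ 5) * (a 2 ^ 5 * a 3 ^ 5) * (a 3 ^ 5 * a 4 ^ 5) := by ring
    _ ≤ P5 a ^ 5 := prod5_le (b013 a h0 h1 h2 h3 h4) (b024 a h0 h1 h2 h3 h4) (b124 a h0 h1 h2 h3 h4) (b23 a h0 h1 h2 h3 h4) (b34 a h0 h1 h2 h3 h4)
        (by positivity) (by positivity) (by positivity) (by positivity) (by positivity)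

theorem c23222 : a 0 ^ 2 * a 1 ^ 3 * a 2 ^ 2 * a 3 ^ 2 * a 4 ^ 2 ≤ P5 a := by
  refine le_of_pow_le_pow_left₀ (by norm_num : (5 : ℕ) ≠ 0) (P5_nonneg a h0 h1 h2 h3 h4) ?_
  calc (a 0 ^ 2 * a 1 ^ 3 * a 2 ^ 2 * a 3 ^ 2 * a 4 ^ 2) ^ 5
      = (a 0 ^ 5 * a 1 ^ 5 * a 3 ^ 5) * (a 0 ^ 5 * a 2 ^ 5) * (a 1 ^ 5 * a 2 ^ 5) * (a 1 ^ 5 * a 4 ^ 5) * (a 3 ^ 5 * a 4 ^ 5) := by ring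
    _ ≤ P5 a ^ 5 := prod5_le (b013 a h0 h1 h2 h3 h4) (b02 a h0 h1 h2 h3 h4) (b12 a h0 h1 h2 h3 h4) (b14 a h0 h1 h2 h3 h4) (b34 a h0 h1 h2 h3 h4)
        (by positivity) (by positivity) (by positivity) (by positivity) (by positivity)

theorem c23223 : a 0 ^ 2 * a 1 ^ 3 * a 2 ^ 2 * a 3 ^ 2 * a 4 ^ 3 ≤ P5 a := by
  refine le_of_pow_le_pow_left₀ (by norm_num : (5 : ℕ) ≠ 0) (P5_nonneg a h0 h1 h2 h3 h4) ?_
  calc (a 0 ^ 2 * a 1 ^ 3 * a 2 ^ 2 * a 3 ^ 2 * a 4 ^ 3) ^ 5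
      = (a 0 ^ 5 * a 1 ^ 5 * a 3 ^ 5) * (a 0 ^ 5 * a 2 ^ 5 * a 4 ^ 5) * (a 1 ^ 5 * a 2 ^ 5) * (a 1 ^ 5 * a 4 ^ 5) * (a 3 ^ 5 * a 4 ^ 5) := by ring
    _ ≤ P5 a ^ 5 := prod5_le (b013 a h0 h1 h2 h3 h4) (b024 a h0 h1 h2 h3 h4) (b12 a h0 h1 h2 h3 h4) (b14 a h0 h1 h2 h3 h4) (b34 a h0 h1 h2 h3 h4)
        (by positivity) (by positivity) (by positivity) (by positivity) (by positivity)

theorem c23232 : a 0 ^ 2 * a 1 ^ 3 * a 2 ^ 2 * a 3 ^ 3 * a 4 ^ 2 ≤ P5 a := by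
  refine le_of_pow_le_pow_left₀ (by norm_num : (5 : ℕ) ≠ 0) (P5_nonneg a h0 h1 h2 h3 h4) ?_
  calc (a 0 ^ 2 * a 1 ^ 3 * a 2 ^ 2 * a 3 ^ 3 * a 4 ^ 2) ^ 5
      = (a 0 ^ 5 * a 1 ^ 5 * a 3 ^ 5) * (a 0 ^ 5 * a 1 ^ 5 * a 4 ^ 5) * (a 1 ^ 5 * a 2 ^ 5) * (a 2 ^ 5 * a 3 ^ 5) * (a 3 ^ 5 * a 4 ^ 5) := by ring
    _ ≤ P5 a ^ 5 := prod5_le (b013 a h0 h1 h2 h3 h4) (b014 a h0 h1 h2 h3 h4) (b12 a h0 h1 h2 h3 h4) (b23 a h0 h1 h2 h3 h4) (b34 a h0 h1 h2 h3 h4)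
        (by positivity) (by positivity) (by positivity) (by positivity) (by positivity)

theorem c23233 : a 0 ^ 2 * a 1 ^ 3 * a 2 ^ 2 * a 3 ^ 3 * a 4 ^ 3 ≤ P5 a := by
  refine le_of_pow_le_pow_left₀ (by norm_num : (5 : ℕ) ≠ 0) (P5_nonneg a h0 h1 h2 h3 h4) ?_
  calc (a 0 ^ 2 * a 1 ^ 3 * a 2 ^ 2 * a 3 ^ 3 * a 4 ^ 3) ^ 5
      = (a 0 ^ 5 * a 1 ^ 5 * a 3 ^ 5) * (a 0 ^ 5 * a 1 ^ 5 * a 4 ^ 5) * (a 1 ^ 5 * a 2 ^ 5 * a 4 ^ 5) * (a 2 ^ 5 * a 3 ^ 5) * (a 3 ^ 5 * a 4 ^ 5) := by ring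
    _ ≤ P5 a ^ 5 := prod5_le (b013 a h0 h1 h2 h3 h4) (b014 a h0 h1 h2 h3 h4) (b124 a h0 h1 h2 h3 h4) (b23 a h0 h1 h2 h3 h4) (b34 a h0 h1 h2 h3 h4)
        (by positivity) (by positivity) (by positivity) (by positivity) (by positivity)

theorem c23322 : a 0 ^ 2 * a 1 ^ 3 * a 2 ^ 3 * a 3 ^ 2 * a 4 ^ 2 ≤ P5 a := by
  refine le_of_pow_le_pow_left₀ (by norm_num : (5 : ℕ) ≠ 0) (P5_nonneg a h0 h1 h2 h3 h4) ?_
  calc (a 0 ^ 2 * a 1 ^ 3 * a 2 ^ 3 * a 3 ^ 2 * a 4 ^ 2) ^ 5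
      = (a 0 ^ 5 * a 1 ^ 5 * a 3 ^ 5) * (a 0 ^ 5 * a 2 ^ 5 * a 4 ^ 5) * (a 1 ^ 5 * a 2 ^ 5) * (a 1 ^ 5 * a 2 ^ 5) * (a 3 ^ 5 * a 4 ^ 5) := by ring
    _ ≤ P5 a ^ 5 := prod5_le (b013 a h0 h1 h2 h3 h4) (b024 a h0 h1 h2 h3 h4) (b12 a h0 h1 h2 h3 h4) (b12 a h0 h1 h2 h3 h4) (b34 a h0 h1 h2 h3 h4)
        (by positivity) (by positivity) (by positivity) (by positivity) (by positivity)

theorem c23323 : a 0 ^ 2 * a 1 ^ 3 * a 2 ^ 3 * a 3 ^ 2 * a 4 ^ 3 ≤ P5 a := by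
  refine le_of_pow_le_pow_left₀ (by norm_num : (5 : ℕ) ≠ 0) (P5_nonneg a h0 h1 h2 h3 h4) ?_
  calc (a 0 ^ 2 * a 1 ^ 3 * a 2 ^ 3 * a 3 ^ 2 * a 4 ^ 3) ^ 5
      = (a 0 ^ 5 * a 1 ^ 5 * a 3 ^ 5) * (a 0 ^ 5 * a 2 ^ 5 * a 4 ^ 5) * (a 1 ^ 5 * a 2 ^ 5 * a 4 ^ 5) * (a 1 ^ 5 * a 2 ^ 5) * (a 3 ^ 5 * a 4 ^ 5) := by ring
    _ ≤ P5 a ^ 5 := prod5_le (b013 a h0 h1 h2 h3 h4) (b024 a h0 h1 h2 h3 h4) (b124 a h0 h1 h2 h3 h4) (b12 a h0 h1 h2 h3 h4) (b34 a h0 h1 h2 h3 h4)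
        (by positivity) (by positivity) (by positivity) (by positivity) (by positivity)

theorem c23332 : a 0 ^ 2 * a 1 ^ 3 * a 2 ^ 3 * a 3 ^ 3 * a 4 ^ 2 ≤ P5 a := by
  refine le_of_pow_le_pow_left₀ (by norm_num : (5 : ℕ) ≠ 0) (P5_nonneg a h0 h1 h2 h3 h4) ?_
  calc (a 0 ^ 2 * a 1 ^ 3 * a 2 ^ 3 * a 3 ^ 3 * a 4 ^ 2) ^ 5
      = (a 0 ^ 5 * a 1 ^ 5 * a 3 ^ 5) * (a 0 ^ 5 * a 1 ^ 5 * a 4 ^ 5) * (a 1 ^ 5 * a 2 ^ 5 * a 4 ^ 5) * (a 2 ^ 5 * a 3 ^ 5) * (a 2 ^ 5 * a 3 ^ 5) := by ring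
    _ ≤ P5 a ^ 5 := prod5_le (b013 a h0 h1 h2 h3 h4) (b014 a h0 h1 h2 h3 h4) (b124 a h0 h1 h2 h3 h4) (b23 a h0 h1 h2 h3 h4) (b23 a h0 h1 h2 h3 h4)
        (by positivity) (by positivity) (by positivity) (by positivity) (by positivity)

theorem c23333 : a 0 ^ 2 * a 1 ^ 3 * a 2 ^ 3 * a 3 ^ 3 * a 4 ^ 3 ≤ P5 a := by
  refine le_of_pow_le_pow_left₀ (by norm_num : (5 : ℕ) ≠ 0) (P5_nonneg a h0 h1 h2 h3 h4) ?_
  calc (a 0 ^ 2 * a 1 ^ 3 * a 2 ^ 3 * a 3 ^ 3 * a 4 ^ 3) ^ 5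
      = (a 0 ^ 5 * a 1 ^ 5 * a 3 ^ 5) * (a 0 ^ 5 * a 1 ^ 5 * a 4 ^ 5) * (a 1 ^ 5 * a 2 ^ 5 * a 4 ^ 5) * (a 2 ^ 5 * a 3 ^ 5 * a 4 ^ 5) * (a 2 ^ 5 * a 3 ^ 5) := by ring
    _ ≤ P5 a ^ 5 := prod5_le (b013 a h0 h1 h2 h3 h4) (b014 a h0 h1 h2 h3 h4) (b124 a h0 h1 h2 h3 h4) (b234 a h0 h1 h2 h3 h4) (b23 a h0 h1 h2 h3 h4)
        (by positivity) (by positivity) (by positivity) (by positivity) (by positivity)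

theorem c32222 : a 0 ^ 3 * a 1 ^ 2 * a 2 ^ 2 * a 3 ^ 2 * a 4 ^ 2 ≤ P5 a := by
  refine le_of_pow_le_pow_left₀ (by norm_num : (5 : ℕ) ≠ 0) (P5_nonneg a h0 h1 h2 h3 h4) ?_
  calc (a 0 ^ 3 * a 1 ^ 2 * a 2 ^ 2 * a 3 ^ 2 * a 4 ^ 2) ^ 5
      = (a 0 ^ 5 * a 1 ^ 5 * a 3 ^ 5) * (a 0 ^ 5 * a 2 ^ 5) * (a 0 ^ 5 * a 2 ^ 5) * (a 1 ^ 5 * a 4 ^ 5) * (a 3 ^ 5 * a 4 ^ 5) := by ring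
    _ ≤ P5 a ^ 5 := prod5_le (b013 a h0 h1 h2 h3 h4) (b02 a h0 h1 h2 h3 h4) (b02 a h0 h1 h2 h3 h4) (b14 a h0 h1 h2 h3 h4) (b34 a h0 h1 h2 h3 h4)
        (by positivity) (by positivity) (by positivity) (by positivity) (by positivity)

theorem c32223 : a 0 ^ 3 * a 1 ^ 2 * a 2 ^ 2 * a 3 ^ 2 * a 4 ^ 3 ≤ P5 a := by
  refine le_of_pow_le_pow_left₀ (by norm_num : (5 : ℕ) ≠ 0) (P5_nonneg a h0 h1 h2 h3 h4) ?_
  calc (a 0 ^ 3 * a 1 ^ 2 * a 2 ^ 2 * a 3 ^ 2 * a 4 ^ 3) ^ 5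
      = (a 0 ^ 5 * a 1 ^ 5 * a 3 ^ 5) * (a 0 ^ 5 * a 2 ^ 5 * a 4 ^ 5) * (a 0 ^ 5 * a 2 ^ 5) * (a 1 ^ 5 * a 4 ^ 5) * (a 3 ^ 5 * a 4 ^ 5) := by ring
    _ ≤ P5 a ^ 5 := prod5_le (b013 a h0 h1 h2 h3 h4) (b024 a h0 h1 h2 h3 h4) (b02 a h0 h1 h2 h3 h4) (b14 a h0 h1 h2 h3 h4) (b34 a h0 h1 h2 h3 h4)
        (by positivity) (by positivity) (by positivity) (by positivity) (by positivity)

theorem c32232 : a 0 ^ 3 * a 1 ^ 2 * a 2 ^ 2 * a 3 ^ 3 * a 4 ^ 2 ≤ P5 a := by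
  refine le_of_pow_le_pow_left₀ (by norm_num : (5 : ℕ) ≠ 0) (P5_nonneg a h0 h1 h2 h3 h4) ?_
  calc (a 0 ^ 3 * a 1 ^ 2 * a 2 ^ 2 * a 3 ^ 3 * a 4 ^ 2) ^ 5
      = (a 0 ^ 5 * a 1 ^ 5 * a 3 ^ 5) * (a 0 ^ 5 * a 1 ^ 5 * a 4 ^ 5) * (a 0 ^ 5 * a 2 ^ 5) * (a 2 ^ 5 * a 3 ^ 5) * (a 3 ^ 5 * a 4 ^ 5) := by ring
    _ ≤ P5 a ^ 5 := prod5_le (b013 a h0 h1 h2 h3 h4) (b014 a h0 h1 h2 h3 h4) (b02 a h0 h1 h2 h3 h4) (b23 a h0 h1 h2 h3 h4) (b34 a h0 h1 h2 h3 h4)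
        (by positivity) (by positivity) (by positivity) (by positivity) (by positivity)

theorem c32233 : a 0 ^ 3 * a 1 ^ 2 * a 2 ^ 2 * a 3 ^ 3 * a 4 ^ 3 ≤ P5 a := by
  refine le_of_pow_le_pow_left₀ (by norm_num : (5 : ℕ) ≠ 0) (P5_nonneg a h0 h1 h2 h3 h4) ?_
  calc (a 0 ^ 3 * a 1 ^ 2 * a 2 ^ 2 * a 3 ^ 3 * a 4 ^ 3) ^ 5
      = (a 0 ^ 5 * a 1 ^ 5 * a 3 ^ 5) * (a 0 ^ 5 * a 1 ^ 5 * a 4 ^ 5) * (a 0 ^ 5 * a 2 ^ 5 * a 4 ^ 5) * (a 2 ^ 5 * a 3 ^ 5) * (a 3 ^ 5 * a 4 ^ 5) := by ring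
    _ ≤ P5 a ^ 5 := prod5_le (b013 a h0 h1 h2 h3 h4) (b014 a h0 h1 h2 h3 h4) (b024 a h0 h1 h2 h3 h4) (b23 a h0 h1 h2 h3 h4) (b34 a h0 h1 h2 h3 h4)
        (by positivity) (by positivity) (by positivity) (by positivity) (by positivity)

theorem c32322 : a 0 ^ 3 * a 1 ^ 2 * a 2 ^ 3 * a 3 ^ 2 * a 4 ^ 2 ≤ P5 a := by
  refine le_of_pow_le_pow_left₀ (by norm_num : (5 : ℕ) ≠ 0) (P5_nonneg a h0 h1 h2 h3 h4) ?_
  calc (a 0 ^ 3 * a 1 ^ 2 * a 2 ^ 3 * a 3 ^ 2 * a 4 ^ 2) ^ 5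
      = (a 0 ^ 5 * a 1 ^ 5 * a 3 ^ 5) * (a 0 ^ 5 * a 2 ^ 5 * a 4 ^ 5) * (a 0 ^ 5 * a 2 ^ 5) * (a 1 ^ 5 * a 2 ^ 5) * (a 3 ^ 5 * a 4 ^ 5) := by ring
    _ ≤ P5 a ^ 5 := prod5_le (b013 a h0 h1 h2 h3 h4) (b024 a h0 h1 h2 h3 h4) (b02 a h0 h1 h2 h3 h4) (b12 a h0 h1 h2 h3 h4) (b34 a h0 h1 h2 h3 h4)
        (by positivity) (by positivity) (by positivity) (by positivity) (by positivity)

theorem c32323 : a 0 ^ 3 * a 1 ^ 2 * a 2 ^ 3 * a 3 ^ 2 * a 4 ^ 3 ≤ P5 a := by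
  refine le_of_pow_le_pow_left₀ (by norm_num : (5 : ℕ) ≠ 0) (P5_nonneg a h0 h1 h2 h3 h4) ?_
  calc (a 0 ^ 3 * a 1 ^ 2 * a 2 ^ 3 * a 3 ^ 2 * a 4 ^ 3) ^ 5
      = (a 0 ^ 5 * a 1 ^ 5 * a 3 ^ 5) * (a 0 ^ 5 * a 2 ^ 5 * a 4 ^ 5) * (a 0 ^ 5 * a 2 ^ 5 * a 4 ^ 5) * (a 1 ^ 5 * a 2 ^ 5) * (a 3 ^ 5 * a 4 ^ 5) := by ring
    _ ≤ P5 a ^ 5 := prod5_le (b013 a h0 h1 h2 h3 h4) (b024 a h0 h1 h2 h3 h4) (b024 a h0 h1 h2 h3 h4) (b12 a h0 h1 h2 h3 h4) (b34 a h0 h1 h2 h3 h4)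
        (by positivity) (by positivity) (by positivity) (by positivity) (by positivity)

theorem c32332 : a 0 ^ 3 * a 1 ^ 2 * a 2 ^ 3 * a 3 ^ 3 * a 4 ^ 2 ≤ P5 a := by
  refine le_of_pow_le_pow_left₀ (by norm_num : (5 : ℕ) ≠ 0) (P5_nonneg a h0 h1 h2 h3 h4) ?_
  calc (a 0 ^ 3 * a 1 ^ 2 * a 2 ^ 3 * a 3 ^ 3 * a 4 ^ 2) ^ 5
      = (a 0 ^ 5 * a 1 ^ 5 * a 3 ^ 5) * (a 0 ^ 5 * a 1 ^ 5 * a 4 ^ 5) * (a 0 ^ 5 * a 2 ^ 5 * a 4 ^ 5) * (a 2 ^ 5 * a 3 ^ 5) * (a 2 ^ 5 * a 3 ^ 5) := by ring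
    _ ≤ P5 a ^ 5 := prod5_le (b013 a h0 h1 h2 h3 h4) (b014 a h0 h1 h2 h3 h4) (b024 a h0 h1 h2 h3 h4) (b23 a h0 h1 h2 h3 h4) (b23 a h0 h1 h2 h3 h4)
        (by positivity) (by positivity) (by positivity) (by positivity) (by positivity)

theorem c32333 : a 0 ^ 3 * a 1 ^ 2 * a 2 ^ 3 * a 3 ^ 3 * a 4 ^ 3 ≤ P5 a := by
  refine le_of_pow_le_pow_left₀ (by norm_num : (5 : ℕ) ≠ 0) (P5_nonneg a h0 h1 h2 h3 h4) ?_
  calc (a 0 ^ 3 * a 1 ^ 2 * a 2 ^ 3 * a 3 ^ 3 * a 4 ^ 3) ^ 5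
      = (a 0 ^ 5 * a 1 ^ 5 * a 3 ^ 5) * (a 0 ^ 5 * a 1 ^ 5 * a 4 ^ 5) * (a 0 ^ 5 * a 2 ^ 5 * a 4 ^ 5) * (a 2 ^ 5 * a 3 ^ 5 * a 4 ^ 5) * (a 2 ^ 5 * a 3 ^ 5) := by ring
    _ ≤ P5 a ^ 5 := prod5_le (b013 a h0 h1 h2 h3 h4) (b014 a h0 h1 h2 h3 h4) (b024 a h0 h1 h2 h3 h4) (b234 a h0 h1 h2 h3 h4) (b23 a h0 h1 h2 h3 h4)
        (by positivity) (by positivity) (by positivity) (by positivity) (by positivity)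

theorem c33222 : a 0 ^ 3 * a 1 ^ 3 * a 2 ^ 2 * a 3 ^ 2 * a 4 ^ 2 ≤ P5 a := by
  refine le_of_pow_le_pow_left₀ (by norm_num : (5 : ℕ) ≠ 0) (P5_nonneg a h0 h1 h2 h3 h4) ?_
  calc (a 0 ^ 3 * a 1 ^ 3 * a 2 ^ 2 * a 3 ^ 2 * a 4 ^ 2) ^ 5
      = (a 0 ^ 5 * a 1 ^ 5 * a 3 ^ 5) * (a 0 ^ 5 * a 1 ^ 5 * a 4 ^ 5) * (a 0 ^ 5 * a 2 ^ 5) * (a 1 ^ 5 * a 2 ^ 5) * (a 3 ^ 5 * a 4 ^ 5) := by ring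
    _ ≤ P5 a ^ 5 := prod5_le (b013 a h0 h1 h2 h3 h4) (b014 a h0 h1 h2 h3 h4) (b02 a h0 h1 h2 h3 h4) (b12 a h0 h1 h2 h3 h4) (b34 a h0 h1 h2 h3 h4)
        (by positivity) (by positivity) (by positivity) (by positivity) (by positivity)

theorem c33223 : a 0 ^ 3 * a 1 ^ 3 * a 2 ^ 2 * a 3 ^ 2 * a 4 ^ 3 ≤ P5 a := by
  refine le_of_pow_le_pow_left₀ (by norm_num : (5 : ℕ) ≠ 0) (P5_nonneg a h0 h1 h2 h3 h4) ?_
  calc (a 0 ^ 3 * a 1 ^ 3 * a 2 ^ 2 * a 3 ^ 2 * a 4 ^ 3) ^ 5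
      = (a 0 ^ 5 * a 1 ^ 5 * a 3 ^ 5) * (a 0 ^ 5 * a 1 ^ 5 * a 4 ^ 5) * (a 0 ^ 5 * a 2 ^ 5 * a 4 ^ 5) * (a 1 ^ 5 * a 2 ^ 5) * (a 3 ^ 5 * a 4 ^ 5) := by ring
    _ ≤ P5 a ^ 5 := prod5_le (b013 a h0 h1 h2 h3 h4) (b014 a h0 h1 h2 h3 h4) (b024 a h0 h1 h2 h3 h4) (b12 a h0 h1 h2 h3 h4) (b34 a h0 h1 h2 h3 h4)
        (by positivity) (by positivity) (by positivity) (by positivity) (by positivity)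

theorem c33232 : a 0 ^ 3 * a 1 ^ 3 * a 2 ^ 2 * a 3 ^ 3 * a 4 ^ 2 ≤ P5 a := by
  refine le_of_pow_le_pow_left₀ (by norm_num : (5 : ℕ) ≠ 0) (P5_nonneg a h0 h1 h2 h3 h4) ?_
  calc (a 0 ^ 3 * a 1 ^ 3 * a 2 ^ 2 * a 3 ^ 3 * a 4 ^ 2) ^ 5
      = (a 0 ^ 5 * a 1 ^ 5 * a 3 ^ 5) * (a 0 ^ 5 * a 1 ^ 5 * a 3 ^ 5) * (a 0 ^ 5 * a 2 ^ 5 * a 4 ^ 5) * (a 1 ^ 5 * a 2 ^ 5) * (a 3 ^ 5 * a 4 ^ 5) := by ring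
    _ ≤ P5 a ^ 5 := prod5_le (b013 a h0 h1 h2 h3 h4) (b013 a h0 h1 h2 h3 h4) (b024 a h0 h1 h2 h3 h4) (b12 a h0 h1 h2 h3 h4) (b34 a h0 h1 h2 h3 h4)
        (by positivity) (by positivity) (by positivity) (by positivity) (by positivity)

theorem c33233 : a 0 ^ 3 * a 1 ^ 3 * a 2 ^ 2 * a 3 ^ 3 * a 4 ^ 3 ≤ P5 a := by
  refine le_of_pow_le_pow_left₀ (by norm_num : (5 : ℕ) ≠ 0) (P5_nonneg a h0 h1 h2 h3 h4) ?_
  calc (a 0 ^ 3 * a 1 ^ 3 * a 2 ^ 2 * a 3 ^ 3 * a 4 ^ 3) ^ 5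
      = (a 0 ^ 5 * a 1 ^ 5 * a 3 ^ 5) * (a 0 ^ 5 * a 1 ^ 5 * a 3 ^ 5) * (a 0 ^ 5 * a 2 ^ 5 * a 4 ^ 5) * (a 1 ^ 5 * a 2 ^ 5 * a 4 ^ 5) * (a 3 ^ 5 * a 4 ^ 5) := by ring
    _ ≤ P5 a ^ 5 := prod5_le (b013 a h0 h1 h2 h3 h4) (b013 a h0 h1 h2 h3 h4) (b024 a h0 h1 h2 h3 h4) (b124 a h0 h1 h2 h3 h4) (b34 a h0 h1 h2 h3 h4)
        (by positivity) (by positivity) (by positivity) (by positivity) (by positivity)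

theorem c33322 : a 0 ^ 3 * a 1 ^ 3 * a 2 ^ 3 * a 3 ^ 2 * a 4 ^ 2 ≤ P5 a := by
  refine le_of_pow_le_pow_left₀ (by norm_num : (5 : ℕ) ≠ 0) (P5_nonneg a h0 h1 h2 h3 h4) ?_
  calc (a 0 ^ 3 * a 1 ^ 3 * a 2 ^ 3 * a 3 ^ 2 * a 4 ^ 2) ^ 5
      = (a 0 ^ 5 * a 1 ^ 5 * a 3 ^ 5) * (a 0 ^ 5 * a 1 ^ 5 * a 4 ^ 5) * (a 0 ^ 5 * a 2 ^ 5 * a 4 ^ 5) * (a 1 ^ 5 * a 2 ^ 5) * (a 2 ^ 5 * a 3 ^ 5) := by ring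
    _ ≤ P5 a ^ 5 := prod5_le (b013 a h0 h1 h2 h3 h4) (b014 a h0 h1 h2 h3 h4) (b024 a h0 h1 h2 h3 h4) (b12 a h0 h1 h2 h3 h4) (b23 a h0 h1 h2 h3 h4)
        (by positivity) (by positivity) (by positivity) (by positivity) (by positivity)

theorem c33323 : a 0 ^ 3 * a 1 ^ 3 * a 2 ^ 3 * a 3 ^ 2 * a 4 ^ 3 ≤ P5 a := by
  refine le_of_pow_le_pow_left₀ (by norm_num : (5 : ℕ) ≠ 0) (P5_nonneg a h0 h1 h2 h3 h4) ?_
  calc (a 0 ^ 3 * a 1 ^ 3 * a 2 ^ 3 * a 3 ^ 2 * a 4 ^ 3) ^ 5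
      = (a 0 ^ 5 * a 1 ^ 5 * a 3 ^ 5) * (a 0 ^ 5 * a 1 ^ 5 * a 4 ^ 5) * (a 0 ^ 5 * a 2 ^ 5 * a 4 ^ 5) * (a 1 ^ 5 * a 2 ^ 5 * a 4 ^ 5) * (a 2 ^ 5 * a 3 ^ 5) := by ring
    _ ≤ P5 a ^ 5 := prod5_le (b013 a h0 h1 h2 h3 h4) (b014 a h0 h1 h2 h3 h4) (b024 a h0 h1 h2 h3 h4) (b124 a h0 h1 h2 h3 h4) (b23 a h0 h1 h2 h3 h4)
        (by positivity) (by positivity) (by positivity) (by positivity) (by positivity)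

theorem c33332 : a 0 ^ 3 * a 1 ^ 3 * a 2 ^ 3 * a 3 ^ 3 * a 4 ^ 2 ≤ P5 a := by
  refine le_of_pow_le_pow_left₀ (by norm_num : (5 : ℕ) ≠ 0) (P5_nonneg a h0 h1 h2 h3 h4) ?_
  calc (a 0 ^ 3 * a 1 ^ 3 * a 2 ^ 3 * a 3 ^ 3 * a 4 ^ 2) ^ 5
      = (a 0 ^ 5 * a 1 ^ 5 * a 3 ^ 5) * (a 0 ^ 5 * a 1 ^ 5 * a 3 ^ 5) * (a 0 ^ 5 * a 2 ^ 5 * a 4 ^ 5) * (a 1 ^ 5 * a 2 ^ 5 * a 4 ^ 5) * (a 2 ^ 5 * a 3 ^ 5) := by ring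
    _ ≤ P5 a ^ 5 := prod5_le (b013 a h0 h1 h2 h3 h4) (b013 a h0 h1 h2 h3 h4) (b024 a h0 h1 h2 h3 h4) (b124 a h0 h1 h2 h3 h4) (b23 a h0 h1 h2 h3 h4)
        (by positivity) (by positivity) (by positivity) (by positivity) (by positivity)

theorem c33333 : a 0 ^ 3 * a 1 ^ 3 * a 2 ^ 3 * a 3 ^ 3 * a 4 ^ 3 ≤ P5 a := by
  refine le_of_pow_le_pow_left₀ (by norm_num : (5 : ℕ) ≠ 0) (P5_nonneg a h0 h1 h2 h3 h4) ?_
  calc (a 0 ^ 3 * a 1 ^ 3 * a 2 ^ 3 * a 3 ^ 3 * a 4 ^ 3) ^ 5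
      = (a 0 ^ 5 * a 1 ^ 5 * a 3 ^ 5) * (a 0 ^ 5 * a 1 ^ 5 * a 3 ^ 5) * (a 0 ^ 5 * a 2 ^ 5 * a 4 ^ 5) * (a 1 ^ 5 * a 2 ^ 5 * a 4 ^ 5) * (a 2 ^ 5 * a 3 ^ 5 * a 4 ^ 5) := by ring
    _ ≤ P5 a ^ 5 := prod5_le (b013 a h0 h1 h2 h3 h4) (b013 a h0 h1 h2 h3 h4) (b024 a h0 h1 h2 h3 h4) (b124 a h0 h1 h2 h3 h4) (b234 a h0 h1 h2 h3 h4)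
        (by positivity) (by positivity) (by positivity) (by positivity) (by positivity)

/-- **Key inequality**: `∏ᵢ (aᵢ² + aᵢ³) ≤ 32 · Ψ(a⁵)` for positive `a`. [folklore] -/
theorem prod_sq_add_cube_le : ∏ i, (a i ^ 2 + a i ^ 3) ≤ 32 * P5 a := by
  calc ∏ i, (a i ^ 2 + a i ^ 3)
      = a 0 ^ 2 * a 1 ^ 2 * a 2 ^ 2 * a 3 ^ 2 * a 4 ^ 2 + a 0 ^ 2 * a 1 ^ 2 * a 2 ^ 2 * a 3 ^ 2 * a 4 ^ 3 +
      a 0 ^ 2 * a 1 ^ 2 * a 2 ^ 2 * a 3 ^ 3 * a 4 ^ 2 + a 0 ^ 2 * a 1 ^ 2 * a 2 ^ 2 * a 3 ^ 3 * a 4 ^ 3 +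
      a 0 ^ 2 * a 1 ^ 2 * a 2 ^ 3 * a 3 ^ 2 * a 4 ^ 2 + a 0 ^ 2 * a 1 ^ 2 * a 2 ^ 3 * a 3 ^ 2 * a 4 ^ 3 +
      a 0 ^ 2 * a 1 ^ 2 * a 2 ^ 3 * a 3 ^ 3 * a 4 ^ 2 + a 0 ^ 2 * a 1 ^ 2 * a 2 ^ 3 * a 3 ^ 3 * a 4 ^ 3 +
      a 0 ^ 2 * a 1 ^ 3 * a 2 ^ 2 * a 3 ^ 2 * a 4 ^ 2 + a 0 ^ 2 * a 1 ^ 3 * a 2 ^ 2 * a 3 ^ 2 * a 4 ^ 3 +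
      a 0 ^ 2 * a 1 ^ 3 * a 2 ^ 2 * a 3 ^ 3 * a 4 ^ 2 + a 0 ^ 2 * a 1 ^ 3 * a 2 ^ 2 * a 3 ^ 3 * a 4 ^ 3 +
      a 0 ^ 2 * a 1 ^ 3 * a 2 ^ 3 * a 3 ^ 2 * a 4 ^ 2 + a 0 ^ 2 * a 1 ^ 3 * a 2 ^ 3 * a 3 ^ 2 * a 4 ^ 3 +
      a 0 ^ 2 * a 1 ^ 3 * a 2 ^ 3 * a 3 ^ 3 * a 4 ^ 2 + a 0 ^ 2 * a 1 ^ 3 * a 2 ^ 3 * a 3 ^ 3 * a 4 ^ 3 +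
      a 0 ^ 3 * a 1 ^ 2 * a 2 ^ 2 * a 3 ^ 2 * a 4 ^ 2 + a 0 ^ 3 * a 1 ^ 2 * a 2 ^ 2 * a 3 ^ 2 * a 4 ^ 3 +
      a 0 ^ 3 * a 1 ^ 2 * a 2 ^ 2 * a 3 ^ 3 * a 4 ^ 2 + a 0 ^ 3 * a 1 ^ 2 * a 2 ^ 2 * a 3 ^ 3 * a 4 ^ 3 +
      a 0 ^ 3 * a 1 ^ 2 * a 2 ^ 3 * a 3 ^ 2 * a 4 ^ 2 + a 0 ^ 3 * a 1 ^ 2 * a 2 ^ 3 * a 3 ^ 2 * a 4 ^ 3 +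
      a 0 ^ 3 * a 1 ^ 2 * a 2 ^ 3 * a 3 ^ 3 * a 4 ^ 2 + a 0 ^ 3 * a 1 ^ 2 * a 2 ^ 3 * a 3 ^ 3 * a 4 ^ 3 +
      a 0 ^ 3 * a 1 ^ 3 * a 2 ^ 2 * a 3 ^ 2 * a 4 ^ 2 + a 0 ^ 3 * a 1 ^ 3 * a 2 ^ 2 * a 3 ^ 2 * a 4 ^ 3 +
      a 0 ^ 3 * a 1 ^ 3 * a 2 ^ 2 * a 3 ^ 3 * a 4 ^ 2 + a 0 ^ 3 * a 1 ^ 3 * a 2 ^ 2 * a 3 ^ 3 * a 4 ^ 3 +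
      a 0 ^ 3 * a 1 ^ 3 * a 2 ^ 3 * a 3 ^ 2 * a 4 ^ 2 + a 0 ^ 3 * a 1 ^ 3 * a 2 ^ 3 * a 3 ^ 2 * a 4 ^ 3 +
      a 0 ^ 3 * a 1 ^ 3 * a 2 ^ 3 * a 3 ^ 3 * a 4 ^ 2 + a 0 ^ 3 * a 1 ^ 3 * a 2 ^ 3 * a 3 ^ 3 * a 4 ^ 3 := by
        rw [Fin.prod_univ_five]; ring
    _ ≤ 32 * P5 a := by
        linarith [c22222 a h0 h1 h2 h3 h4, c22223 a h0 h1 h2 h3 h4, c22232 a h0 h1 h2 h3 h4, c22233 a h0 h1 h2 h3 h4, c22322 a h0 h1 h2 h3 h4, c22323 a h0 h1 h2 h3 h4, c22332 a h0 h1 h2 h3 h4, c22333 a h0 h1 h2 h3 h4, c23222 a h0 h1 h2 h3 h4, c23223 a h0 h1 h2 h3 h4, c23232 a h0 h1 h2 h3 h4, c23233 a h0 h1 h2 h3 h4, c23322 a h0 h1 h2 h3 h4, c23323 a h0 h1 h2 h3 h4, c23332 a h0 h1 h2 h3 h4, c23333 a h0 h1 h2 h3 h4, c32222 a h0 h1 h2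 h3 h4, c32223 a h0 h1 h2 h3 h4, c32232 a h0 h1 h2 h3 h4, c32233 a h0 h1 h2 h3 h4, c32322 a h0 h1 h2 h3 h4, c32323 a h0 h1 h2 h3 h4, c32332 a h0 h1 h2 h3 h4, c32333 a h0 h1 h2 h3 h4, c33222 a h0 h1 h2 h3 h4, c33223 a h0 h1 h2 h3 h4, c33232 a h0 h1 h2 h3 h4, c33233 a h0 h1 h2 h3 h4, c33322 a h0 h1 h2 h3 h4, c33323 a h0 h1 h2 h3 h4, c33332 a h0 h1 h2 h3 h4, c33333 a h0 h1 h2 h3 h4]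

end corners

/-! ### Absolute convergence of the `K₄` period from the key inequality -/

/-- Fifth root. [folklore] -/
def rt (t : ℝ) : ℝ := t ^ ((5 : ℝ)⁻¹)

theorem rt_pos {t : ℝ} (ht : 0 < t) : 0 < rt t := Real.rpow_pos_of_pos ht _

theorem rt_nonneg {t : ℝ} (ht : 0 ≤ t) : 0 ≤ rt t := Real.rpow_nonneg ht _

theorem rt_pow_five {t : ℝ} (ht : 0 ≤ t) : rt t ^ 5 = t := by
  have h := Real.rpow_inv_natCast_pow ht (n := 5) (by norm_num)
  simpa [rt] using h

theorem rt_pow (t : ℝ) (ht : 0 ≤ t) (n : ℕ) : rt t ^ n = t ^ ((5 : ℝ)⁻¹ * n) := by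
  rw [rt, Real.rpow_mul_natCast ht]

/-- The one-variable majorant `g(t) = 1/(t^{2/5} + t^{3/5})²`. [folklore] -/
def g (t : ℝ) : ℝ := 1 / (rt t ^ 2 + rt t ^ 3) ^ 2

theorem g_nonneg (t : ℝ) : 0 ≤ g t := by unfold g; positivity

theorem measurable_g : Measurable g := by
  unfold g rt; fun_prop

theorem g_le_small {t : ℝ} (ht : 0 < t) : g t ≤ t ^ (-(4 / 5 : ℝ)) := by
  have hρ := rt_pos ht
  have h1 : g t ≤ 1 / (rt t ^ 2) ^ 2 := by
    unfold g
    gcongr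
    nlinarith [pow_pos hρ 3]
  have h2 : 1 / (rt t ^ 2) ^ 2 = t ^ (-(4 / 5 : ℝ)) := by
    rw [← pow_mul, rt_pow t ht.le, one_div, ← Real.rpow_neg ht.le]
    norm_num
  exact h1.trans h2.le

theorem g_le_large {t : ℝ} (ht : 0 < t) : g t ≤ t ^ (-(6 / 5 : ℝ)) := by
  have hρ := rt_pos ht
  have h1 : g t ≤ 1 / (rt t ^ 3) ^ 2 := by
    unfold g
    gcongr
    nlinarith [pow_pos hρ 2]
  have h2 : 1 / (rt t ^ 3) ^ 2 = t ^ (-(6 / 5 : ℝ)) := by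
    rw [← pow_mul, rt_pow t ht.le, one_div, ← Real.rpow_neg ht.le]
    norm_num
  exact h1.trans h2.le

/-- `g` is integrable on `(0, ∞)` (like `t^{-4/5}` at `0` and `t^{-6/5}` at `∞`). [folklore] -/
theorem integrableOn_g : IntegrableOn g (Ioi 0) volume := by
  rw [← Ioc_union_Ioi_eq_Ioi zero_le_one, integrableOn_union]
  constructor
  · rw [integrableOn_Ioc_iff_integrableOn_Ioo]
    have h1 : IntegrableOn (fun t : ℝ => t ^ (-(4 / 5 : ℝ))) (Ioo 0 1) volume :=
      (intervalIntegral.integrableOn_Ioo_rpow_iff zero_lt_one).2 (by norm_num)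
    refine h1.mono' measurable_g.aestronglyMeasurable ?_
    refine (ae_restrict_iff' measurableSet_Ioo).2 (Filter.Eventually.of_forall fun t ht => ?_)
    rw [Real.norm_of_nonneg (g_nonneg t)]
    exact g_le_small ht.1
  · have h2 : IntegrableOn (fun t : ℝ => t ^ (-(6 / 5 : ℝ))) (Ioi 1) volume :=
      integrableOn_Ioi_rpow_of_lt (by norm_num) zero_lt_one
    refine h2.mono' measurable_g.aestronglyMeasurable ?_
    refine (ae_restrict_iff' measurableSet_Ioi).2 (Filter.Eventually.of_forall fun t ht => ?_)
    rw [Real.norm_of_nonneg (g_nonneg t)]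
    exact g_le_large (zero_lt_one.trans ht)

theorem orthant_eq_pi : orthant = Set.univ.pi (fun _ : Fin 5 => Ioi (0 : ℝ)) := by
  ext x; simp [orthant]

/-- The product majorant is integrable on the orthant (Tonelli for products). [folklore] -/
theorem integrableOn_prod_g : IntegrableOn (fun x : Fin 5 → ℝ => ∏ i, g (x i)) orthant volume := by
  rw [orthant_eq_pi, IntegrableOn, volume_pi, Measure.restrict_pi_pi]
  exact Integrable.fintype_prod (f := fun _ => g) (μ := fun _ => volume.restrict (Ioi (0 : ℝ)))
    (fun _ => integrableOn_g)

/-- The pointwise domination `1/Ψ² ≤ 1024 ∏ g(xᵢ)` on the orthant. [folklore] -/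
theorem wheel_le_prod_g (x : Fin 5 → ℝ) (hx : x ∈ orthant) :
    1 / psi x ^ 2 ≤ 1024 * ∏ i, g (x i) := by
  have hρ : ∀ i, 0 < rt (x i) := fun i => rt_pos (hx i)
  have key := prod_sq_add_cube_le (fun i => rt (x i)) (hρ 0) (hρ 1) (hρ 2) (hρ 3) (hρ 4)
  have hP5 : P5 (fun i => rt (x i)) = psi x := by
    simp only [P5, rt_pow_five (le_of_lt (hx _))]
  rw [hP5] at key
  have hS0 : 0 < ∏ i, (rt (x i) ^ 2 + rt (x i) ^ 3) :=
    Finset.prod_pos fun i _ => by have := hρ i; positivity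
  have hprod : ∏ i, g (x i) = 1 / (∏ i, (rt (x i) ^ 2 + rt (x i) ^ 3)) ^ 2 := by
    simp only [g]
    rw [Finset.prod_div_distrib, Finset.prod_const_one, Finset.prod_pow]
  rw [hprod, mul_one_div]
  have hpsi : 0 < psi x := psi_pos hx
  rw [div_le_div_iff₀ (by positivity) (by positivity)]
  nlinarith [key, hS0.le, hpsi.le]

theorem continuous_psi : Continuous psi := by unfold psi; fun_prop

/-- **Absolute convergence of the `K₄` period**: `1/Ψ²` is integrable on `ℝ₊⁵`. [folklore] -/
theorem integrableOn_wheelIntegrand : IntegrableOn (fun x => 1 / psi x ^ 2) orthant volume := by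
  refine Integrable.mono' (integrableOn_prod_g.const_mul 1024) ?_ ?_
  · exact (measurable_const.div (continuous_psi.measurable.pow_const 2)).aestronglyMeasurable
  · refine (ae_restrict_iff' isOpen_orthant.measurableSet).2 (Filter.Eventually.of_forall fun x hx => ?_)
    rw [Real.norm_of_nonneg (by positivity)]
    exact wheel_le_prod_g x hx


/-- **The wheel representation exists**: `[ℝ₊⁵, 1/Ψ_{K₄}(x,1)²]` as a `KZ.IntegralRep 5`
(non-vacuity of the left-hand side of the crux; absolute convergence = `integrableOn_wheelIntegrand`,
semialgebraicity from `p/q = 1/Ψ²`). [folklore] -/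
def wheelRep : KZ.IntegralRep 5 where
  domain := orthant
  integrand := wheelIntegrand
  isSemialgebraic_domain := isSemialgebraic_orthant
  isSemialgebraicFunOn_integrand := by
    refine (isSemialgebraicFunOn_aeval_div_aeval isSemialgebraic_orthant (1 : MvPolynomial (Fin 5) ℚ)
      (psiPoly ^ 2) ?_).congr ?_
    · intro x hx
      simpa using (psi_pos hx).ne'
    · intro x _
      simp [wheelIntegrand]
  integrableOn := integrableOn_wheelIntegrand

theorem wheelRep_H1 : H1 wheelRep := rfl
theorem wheelRep_H2 : H2 wheelRep := fun _ _ => rfl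

theorem exists_wheelRep : ∃ r : KZ.IntegralRep 5, H1 r ∧ H2 r := ⟨wheelRep, wheelRep_H1, wheelRep_H2⟩

/-- **The crux is non-vacuous**: both representations exist with exactly the typed data. [folklore] -/
theorem wheelThreeSpokes_nonvacuous :
    ∃ (r : KZ.IntegralRep 5) (r' : KZ.IntegralRep 3), H1 r ∧ H2 r ∧ H3 r' ∧ H4 r' :=
  ⟨wheelRep, zeta3Rep, wheelRep_H1, wheelRep_H2, zeta3Rep_H3, zeta3Rep_H4⟩

/-- **H3 is load-bearing**, unconditionally. [folklore] -/
theorem wheelThreeSpokes_false_without_H3' : ¬ WheelThreeSpokesWithoutH3 :=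
  wheelThreeSpokes_false_without_H3 exists_wheelRep

/-- **H4 is load-bearing**, unconditionally. [folklore] -/
theorem wheelThreeSpokes_false_without_H4' : ¬ WheelThreeSpokesWithoutH4 :=
  wheelThreeSpokes_false_without_H4 exists_wheelRep

/-- The value of the canonical wheel representation is positive (`P(K₄) > 0`). [folklore] -/
theorem value_wheelRep_pos : 0 < wheelRep.value := value_pos_left _ wheelRep_H1 wheelRep_H2


/-! ## §5 NEAR-MISS IN THE PROVERS' FAVOUR: the first moves of a convergent RATIONAL chain (paper chain,
algebraic certificates checked here)

Trying to locate WHERE a chain must regularise, the disprover instead found that the first four moves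
go through with absolutely convergent, positive, rational intermediates and rational primitives — no
`reglim`, no divergent word. Notation (chart `x₅ = α₃₄ = 1`; `e = e₂₄ ↔ x₄`, `f = e₂₃ ↔ x₃`):
`Ψ = A·x₄ + B` (deletion–contraction, `A = Ψ_{K₄∖e}`, `B = Ψ_{K₄/e}`), `A = a₁x₃ + a₀`, `B = b₁x₃ + b₀`
(the four second minors), `D = x₀(1+x₁+x₂) + x₁x₂` (Dodgson: `a₀b₁ − a₁b₀ = D²`).
* (m1) rule 2, `x₄ = u/(1−u)`: `[ℝ₊⁵, 1/Ψ²] → [ℝ₊⁴×(0,1), 1/(Au + B(1−u))²]`;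
* (m2) rule 3 along `u ∈ [0,1]` with the RATIONAL primitive `F(x,u) = u/(B(Au + B(1−u)))`
  (`F(·,0) = 0`, `F(·,1) = 1/(AB)`, `∂ᵤF = 1/(Au+B(1−u))²`): `→ [ℝ₊⁴, 1/(AB)]` (convergent by Tonelli);
* (m3) rule 2, fibrewise Möbius `s = a₁x₃/(a₁x₃ + a₀)` (injective, onto `(0,1)`):
  `→ [ℝ₊³×(0,1), 1/((1−s)a₁b₀ + s a₀b₁)]` — the logarithm `log(a₀b₁/(a₁b₀))` of the printed evaluations
  is never formed; it stays unfolded as the variable `s`;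
* (m4) rule 2, `s = w(p−w)/q` (`p = x₁+x₂`, `q = x₁x₂`, `w ∈ (0, min(x₁,x₂))`, strictly increasing):
  the denominator FACTORS into two forms linear in `x₀`:
  `q((1−s)a₁b₀ + s a₀b₁) = (w a₁ x₀ + (1+w)q)((p−w) a₁ x₀ + (p−w+1) q)`, and with `c = a₁x₀ + q` the
  new integrand is `(p−2w)/((cw+q)(c(p−w)+q)) = (1/c)(1/(cw+q) − 1/(c(p−w)+q))`, both partial
  fractions being separately absolutely convergent on the cell (hand asymptotics; rule 1b then legal),
  and after the blow-up `w' = cw/q` the variable `x₀` enters only through `1/c²` — a second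
  Newton–Leibniz move with rational primitive (`4 → 3`) is available.
* BETTER THAN (m4) — THE SECOND DIMENSION DROP, found afterwards (see `m5_*`, `m6_*` below): write the
  (m3) denominator as a PENCIL `den = a₁b₀ + s·D²` (Dodgson). Then
  `1/den = ∂_{x₀}Φ + N/den²`, `Φ = −D/(a₁·den)` RATIONAL, `N = a₁p x₀ + q(2+p) > 0`
  (integration by parts in `x₀` against `1/D² = ∂_{x₀}(−1/(a₁D))`, kept unfolded), so by rule 1b
  (both pieces absolutely convergent: `N/den² > 0` with finite integral, the other a difference of
  integrable functions) `R4 = R4a + R4b`, and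
  (m5) rule 2 (`x₀ = v/(1−v)`) + rule 3 along `v` with primitive `Φ` (`Φ(·,∞) = 0`,
  `Φ(·,0) = −1/(a₁(a₁+sq))`): `R4a ~ R3a := [(0,1)×ℝ₊², 1/((1+x₁+x₂)(1+x₁+x₂+s x₁x₂))]`;
  (m6) rule 3 along `s ∈ [0,1]` with the RATIONAL primitive `−N/(D²·den)` (`den` is LINEAR in `s`):
  `R4b ~ R3b := [ℝ₊³, N/(a₁b₀·a₀b₁)]`.
  Hence `[ℝ₊⁵, 1/Ψ²] ≡ [R3a] + [R3b] (mod KZ.relations)` with BOTH summands three-dimensional,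
  positive, rational, absolutely convergent — the wheel reaches the dimension of the target with no
  regularisation anywhere. What is NOT settled: the three-dimensional endgame
  `[R3a] + [R3b] ~ [Δ₃, 6/(t₀t₁(1−t₂))]` (merge by disjoint union, then a Beukers-type chain; the
  values `R3a/ζ(3) = 2`, `R3b/ζ(3) = 4` confirmed to 1e-12, evidence `numerics.txt`).
The identities making (m1)–(m6) instances of the rules are certified below by `ring`/`field_simp`;
the analytic side conditions (semialgebraicity of rational maps, monotonicity, Tonelli) are routine.
Numerical values of every intermediate: evidence `numerics.txt` (local tanh–sinh, 1e-9…1e-12). -/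

section PaperChain

variable (x0 x1 x2 x3 x4 : ℝ)

/-- `A = Ψ_{K₄∖e₂₄}(x₀,x₁,x₂,x₃,1)` (two triangles sharing `e₁₃`). [folklore] -/
def minorA (x0 x1 x2 x3 : ℝ) : ℝ := x1 * (x0 + x2 + x3 + 1) + (x0 + x3) * (x2 + 1)
/-- `B = Ψ_{K₄/e₂₄}(x₀,x₁,x₂,x₃,1)` (a triangle with two doubled sides). [folklore] -/
def minorB (x0 x1 x2 x3 : ℝ) : ℝ := x1 * (x0 + x2) * (x3 + 1) + (x0 + x2) * x3 + x0 * x2 * (x3 + 1)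
/-- `a₁ = Ψ_{K₄∖e₂₄∖e₂₃}`. [folklore] -/
def minA1 (x1 x2 : ℝ) : ℝ := 1 + x1 + x2
/-- `a₀ = Ψ_{K₄∖e₂₄/e₂₃}`. [folklore] -/
def minA0 (x0 x1 x2 : ℝ) : ℝ := x0 * (1 + x1 + x2) + x1 * (1 + x2)
/-- `b₁ = Ψ_{K₄/e₂₄∖e₂₃}`. [folklore] -/
def minB1 (x0 x1 x2 : ℝ) : ℝ := x0 * (1 + x1 + x2) + x2 * (1 + x1)
/-- `b₀ = Ψ_{K₄/e₂₄/e₂₃}`. [folklore] -/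
def minB0 (x0 x1 x2 : ℝ) : ℝ := x0 * x1 + x0 * x2 + x1 * x2
/-- The Dodgson polynomial `D = Ψ^{e₂₄,e₂₃}`. [folklore] -/
def dodgsonD (x0 x1 x2 : ℝ) : ℝ := x0 * (1 + x1 + x2) + x1 * x2

/-- Deletion–contraction along `e₂₄`: `Ψ = A x₄ + B`. [folklore] -/
theorem psi_eq_minorA_mul_add : psi ![x0, x1, x2, x3, x4] = minorA x0 x1 x2 x3 * x4 + minorB x0 x1 x2 x3 := by
  simp [psi, minorA, minorB]; ring

/-- Deletion–contraction along `e₂₃`: `A = a₁x₃ + a₀`, `B = b₁x₃ + b₀`. [folklore] -/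
theorem minors_linear_in_x3 :
    minorA x0 x1 x2 x3 = minA1 x1 x2 * x3 + minA0 x0 x1 x2 ∧
      minorB x0 x1 x2 x3 = minB1 x0 x1 x2 * x3 + minB0 x0 x1 x2 := by
  constructor <;> simp [minorA, minorB, minA1, minA0, minB1, minB0] <;> ring

/-- **Dodgson identity** for `(K₄; e₂₄, e₂₃)`: `a₀b₁ − a₁b₀ = D²` (the five-invariant is a square).
[folklore] -/
theorem dodgson_identity :
    minA0 x0 x1 x2 * minB1 x0 x1 x2 - minA1 x1 x2 * minB0 x0 x1 x2 = dodgsonD x0 x1 x2 ^ 2 := by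
  simp [minA1, minA0, minB1, minB0, dodgsonD]; ring

/-- (m1) The compactifying change of variables `x₄ = u/(1−u)`: integrand identity
`(1/Ψ²)(x, u/(1−u)) · 1/(1−u)² = 1/(A u + B (1−u))²` (`u ≠ 1`). [folklore] -/
theorem m1_compactify_identity (A B u : ℝ) (hu : u ≠ 1) :
    1 / (A * (u / (1 - u)) + B) ^ 2 * (1 / (1 - u) ^ 2) = 1 / (A * u + B * (1 - u)) ^ 2 := by
  have h1 : 1 - u ≠ 0 := sub_ne_zero.mpr (Ne.symm hu)
  field_simp

/-- (m2) The Newton–Leibniz primitive is RATIONAL: `F(u) = u/(B(Au + B(1−u)))` has `F(0) = 0`,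
`F(1) = 1/(AB)` … [folklore] -/
theorem m2_primitive_endpoints (A B : ℝ) :
    (0 : ℝ) / (B * (A * 0 + B * (1 - 0))) = 0 ∧ 1 / (B * (A * 1 + B * (1 - 1))) = 1 / (A * B) := by
  constructor
  · simp
  · simp only [mul_one, sub_self, mul_zero, add_zero, mul_comm]

/-- … and derivative the integrand: `F'(u) = 1/(Au + B(1−u))²` wherever the denominator is non-zero
(on the closed fibre `[0,1]` when `A, B > 0`). [folklore] -/
theorem m2_primitive_hasDerivAt (A B u : ℝ) (hB : B ≠ 0) (hden : A * u + B * (1 - u) ≠ 0) :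
    HasDerivAt (fun v : ℝ => v / (B * (A * v + B * (1 - v)))) (1 / (A * u + B * (1 - u)) ^ 2) u := by
  have hd : HasDerivAt (fun v : ℝ => B * (A * v + B * (1 - v))) (B * (A * 1 + B * -1)) u :=
    (((hasDerivAt_id' u).const_mul A).add (((hasDerivAt_id' u).const_sub 1).const_mul B)).const_mul B
  have hq : B * (A * u + B * (1 - u)) ≠ 0 := mul_ne_zero hB hden
  have key := (hasDerivAt_id' u).div hd hq
  refine key.congr_deriv ?_
  field_simp
  ring

/-- (m3) The fibrewise Möbius change of variables `s = a₁x₃/(a₁x₃ + a₀)` turns `dx₃/(AB)` into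
`ds/((1−s)a₁b₀ + s a₀b₁)`: integrand identity with the Jacobian `ds/dx₃ = a₁a₀/(a₁x₃+a₀)²`. [folklore] -/
theorem m3_moebius_identity (a1 a0 b1 b0 t : ℝ) (ha1 : 0 < a1) (ha0 : 0 < a0) (hb1 : 0 < b1)
    (hb0 : 0 < b0) (ht : 0 ≤ t) :
    1 / ((1 - a1 * t / (a1 * t + a0)) * (a1 * b0) + a1 * t / (a1 * t + a0) * (a0 * b1)) *
        (a1 * a0 / (a1 * t + a0) ^ 2) = 1 / ((a1 * t + a0) * (b1 * t + b0)) := by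
  have h1 : a1 * t + a0 ≠ 0 := by positivity
  have h2 : b1 * t + b0 ≠ 0 := by positivity
  have h3 : a0 ≠ 0 := ha0.ne'
  have h4 : a1 ≠ 0 := ha1.ne'
  have hX : (1 - a1 * t / (a1 * t + a0)) * (a1 * b0) + a1 * t / (a1 * t + a0) * (a0 * b1) =
      a0 * a1 * (b1 * t + b0) / (a1 * t + a0) := by
    field_simp
    ring
  rw [hX]
  field_simp

/-- (m3) The Möbius map is a bijection `(0,∞) → (0,1)` on each fibre: derivative `a₁a₀/(a₁t+a₀)² > 0`.
[folklore] -/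
theorem m3_moebius_hasDerivAt (a1 a0 t : ℝ) (h : a1 * t + a0 ≠ 0) :
    HasDerivAt (fun x : ℝ => a1 * x / (a1 * x + a0)) (a1 * a0 / (a1 * t + a0) ^ 2) t := by
  have hn : HasDerivAt (fun x : ℝ => a1 * x) a1 t := by simpa using (hasDerivAt_id t).const_mul a1
  have hd : HasDerivAt (fun x : ℝ => a1 * x + a0) a1 t := by simpa using hn.add_const a0
  refine (hn.div hd h).congr_deriv ?_
  field_simp
  ring

/-- (m4) The rationalising change of variables `s = w(p−w)/q` FACTORS the denominator into two forms
linear in `x₀`: `q·((1−s)a₁b₀ + s a₀b₁) = (w a₁ x₀ + (1+w) q)((p−w) a₁ x₀ + (p−w+1) q)`,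
`p = x₁+x₂`, `q = x₁x₂`. [folklore] -/
theorem m4_factorisation (w : ℝ) :
    let p := x1 + x2
    let q := x1 * x2
    q * ((q - w * (p - w)) * (minA1 x1 x2 * minB0 x0 x1 x2) +
        w * (p - w) * (minA0 x0 x1 x2 * minB1 x0 x1 x2)) =
      q * ((w * minA1 x1 x2 * x0 + (1 + w) * q) * ((p - w) * minA1 x1 x2 * x0 + (p - w + 1) * q)) := by
  simp only [minA1, minA0, minB1, minB0]
  ring

/-- (m4) Partial fractions of the new integrand: with `c = a₁x₀ + q`,
`(p−2w)/((cw+q)(c(p−w)+q)) = (1/c)(1/(cw+q) − 1/(c(p−w)+q))`. [folklore] -/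
theorem m4_partial_fractions (c p q w L1 L2 : ℝ) (hL1 : L1 = c * w + q) (hL2 : L2 = c * (p - w) + q)
    (hc : c ≠ 0) (h1 : L1 ≠ 0) (h2 : L2 ≠ 0) :
    (p - 2 * w) / (L1 * L2) = 1 / c * (1 / L1 - 1 / L2) := by
  have hsub : L2 - L1 = c * (p - 2 * w) := by rw [hL1, hL2]; ring
  rw [one_div L1, one_div L2, inv_sub_inv h1 h2, hsub]
  field_simp

/-- The (m3) denominator is a PENCIL in `s`: `(1−s)a₁b₀ + s a₀b₁ = a₁b₀ + s·D²` (Dodgson). [folklore] -/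
theorem pencil_eq (s : ℝ) :
    (1 - s) * (minA1 x1 x2 * minB0 x0 x1 x2) + s * (minA0 x0 x1 x2 * minB1 x0 x1 x2) =
      minA1 x1 x2 * minB0 x0 x1 x2 + s * dodgsonD x0 x1 x2 ^ 2 := by
  simp [minA1, minA0, minB1, minB0, dodgsonD]; ring

/-- (m5/m6 split) The polynomial identity behind `1/den = ∂_{x₀}(−D/(a₁ den)) + N/den²`:
`2a₁·den − D·∂_{x₀}den = a₁·N` with `N = a₁ p x₀ + q(2+p)`, `p = x₁+x₂`, `q = x₁x₂`
(so the bulk term of the unfolded integration by parts is the POSITIVE rational function `N/den²`).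
[folklore] -/
theorem ibp_polynomial_identity (s : ℝ) :
    let a1 := minA1 x1 x2
    let p := x1 + x2
    let q := x1 * x2
    let den := a1 * minB0 x0 x1 x2 + s * dodgsonD x0 x1 x2 ^ 2
    let dden := 2 * s * a1 ^ 2 * x0 + a1 * (p + 2 * s * q)   -- ∂_{x₀} den
    2 * a1 * den - dodgsonD x0 x1 x2 * dden = a1 * (a1 * p * x0 + q * (2 + p)) := by
  simp only [minA1, minB0, dodgsonD]
  ring

/-- (m5/m6 split) `∂_{x₀} den` is as claimed: `den = s a₁² x₀² + a₁(p + 2sq) x₀ + q(a₁ + sq)`. [folklore] -/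
theorem pencil_expand (s : ℝ) :
    minA1 x1 x2 * minB0 x0 x1 x2 + s * dodgsonD x0 x1 x2 ^ 2 =
      s * minA1 x1 x2 ^ 2 * x0 ^ 2 + minA1 x1 x2 * ((x1 + x2) + 2 * s * (x1 * x2)) * x0 +
        (x1 * x2) * (minA1 x1 x2 + s * (x1 * x2)) := by
  simp only [minA1, minB0, dodgsonD]; ring

/-- (m5) The abstract calculus identity: for `den = D·E`-free notation, with `Φ = −D/(a₁ den)`,
`∂Φ = 1/den − (2a₁ den − D den')/(a₁ den²)` (quotient rule; `D' = a₁`). Stated for real functions of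
one variable. [folklore] -/
theorem m5_quotient_rule (a1 x : ℝ) (Dv denv Dd dend : ℝ) {Df denf : ℝ → ℝ}
    (hD : HasDerivAt Df Dd x) (hden : HasDerivAt denf dend x) (ha1 : a1 ≠ 0) (hDv : Df x = Dv)
    (hdv : denf x = denv) (hdenv : denv ≠ 0) (hDd : Dd = a1) :
    HasDerivAt (fun y => -Df y / (a1 * denf y)) (1 / denv - (2 * a1 * denv - Dv * dend) / (a1 * denv ^ 2)) x := by
  have h1 : HasDerivAt (fun y => a1 * denf y) (a1 * dend) x := hden.const_mul a1
  have hne : a1 * denf x ≠ 0 := by rw [hdv]; exact mul_ne_zero ha1 hdenv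
  have key := (hD.neg.div h1 hne)
  refine key.congr_deriv ?_
  simp only [Pi.neg_apply]
  rw [hDv, hdv, hDd]
  field_simp
  ring

/-- (m5) Endpoint of the rational primitive at `x₀ = 0`: `Φ(0) = −D(0)/(a₁ den(0)) = −1/(a₁(a₁ + s q))`
(uses `(1+x₁)(1+x₂) = a₁ + q`). [folklore] -/
theorem m5_primitive_at_zero (s : ℝ) (hx1 : 0 < x1) (hx2 : 0 < x2) (hs : 0 ≤ s) :
    -(dodgsonD 0 x1 x2) / (minA1 x1 x2 * (minA1 x1 x2 * minB0 0 x1 x2 + s * dodgsonD 0 x1 x2 ^ 2)) =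
      -1 / (minA1 x1 x2 * (minA1 x1 x2 + s * (x1 * x2))) := by
  have hq : x1 * x2 ≠ 0 := by positivity
  have ha : (1 + x1 + x2) ≠ 0 := by positivity
  have hb : (1 + x1 + x2 + s * (x1 * x2)) ≠ 0 := by positivity
  simp only [dodgsonD, minA1, minB0, zero_mul, zero_add]
  rw [div_eq_div_iff (by positivity) (by positivity)]
  ring

/-- (m6) Newton–Leibniz along `s` with a RATIONAL primitive, because `den` is linear in `s`:
`F(s) = −N/(β(α + sβ))` has `F'(s) = N/(α+sβ)²` … [folklore] -/
theorem m6_primitive_hasDerivAt (N α β s : ℝ) (hβ : β ≠ 0) (hden : α + s * β ≠ 0) :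
    HasDerivAt (fun t : ℝ => -N / (β * (α + t * β))) (N / (α + s * β) ^ 2) s := by
  have hd : HasDerivAt (fun t : ℝ => β * (α + t * β)) (β * (1 * β)) s :=
    (((hasDerivAt_id' s).mul_const β).const_add α).const_mul β
  have hq : β * (α + s * β) ≠ 0 := mul_ne_zero hβ hden
  have key := (hasDerivAt_const s (-N)).div hd hq
  refine key.congr_deriv ?_
  field_simp
  ring

/-- … and `F(1) − F(0) = N/(α(α+β))`; with `α = a₁b₀`, `β = D²`, `α + β = a₀b₁` (Dodgson) this is the
integrand `N/(a₁b₀·a₀b₁)` of `R3b`. [folklore] -/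
theorem m6_primitive_endpoints (N α β : ℝ) (hα : α ≠ 0) (hβ : β ≠ 0) (hαβ : α + β ≠ 0) :
    -N / (β * (α + 1 * β)) - -N / (β * (α + 0 * β)) = N / (α * (α + β)) := by
  simp only [zero_mul, add_zero, one_mul]
  field_simp
  ring

/-- The two three-dimensional positive rational representations reached by the chain:
`R3a = [(0,1)×ℝ₊², 1/((1+x₁+x₂)(1+x₁+x₂+s·x₁x₂))]` … [folklore] -/
def r3aIntegrand (s x1 x2 : ℝ) : ℝ := 1 / ((1 + x1 + x2) * (1 + x1 + x2 + s * (x1 * x2)))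

/-- … and `R3b = [ℝ₊³, (a₁(x₁+x₂)x₀ + x₁x₂(2+x₁+x₂))/(a₁b₀·a₀b₁)]`; the chain gives
`[ℝ₊⁵, 1/Ψ²] ≡ [R3a] + [R3b] (mod KZ.relations)` on paper (eight rule instances + permutations). [folklore] -/
def r3bIntegrand (x0 x1 x2 : ℝ) : ℝ :=
  (minA1 x1 x2 * (x1 + x2) * x0 + x1 * x2 * (2 + x1 + x2)) /
    (minA1 x1 x2 * minB0 x0 x1 x2 * (minA0 x0 x1 x2 * minB1 x0 x1 x2))

theorem r3aIntegrand_pos {s x1 x2 : ℝ} (hs : 0 ≤ s) (h1 : 0 < x1) (h2 : 0 < x2) : 0 < r3aIntegrand s x1 x2 := by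
  unfold r3aIntegrand; positivity

theorem r3bIntegrand_pos {x0 x1 x2 : ℝ} (h0 : 0 < x0) (h1 : 0 < x1) (h2 : 0 < x2) : 0 < r3bIntegrand x0 x1 x2 := by
  unfold r3bIntegrand minA1 minB0 minA0 minB1; positivity

/-! ### The endgame for `R3a` is COMPLETE on paper; `R3b` reduces to one explicit 3-dim identity

`R3a` (value `2ζ(3)`): compactify `x₁ = x/(1−x)`, `x₂ = y/(1−y)` (rule 2) and rename `z = 1 − s`
(rule 2): the integrand becomes `1/((1−xy)(1−xyz))` on the open cube (`r3a_cube_identity`); the cube →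
simplex map `(t₀,t₁,t₂) = (x, xy, xyz)` (rule 2, Jacobian `1/(t₀t₁)`) gives `[Δ₃, 1/(t₀·t₁(1−t₁)·(1−t₂))]`;
`1/(t₁(1−t₁)) = 1/t₁ + 1/(1−t₁)` (rule 1b; both words `001 = ζ(3)` and `011 = ζ(2,1)` are admissible,
so both pieces converge); duality `tᵢ ↦ 1 − t₂₋ᵢ` (rule 2, the tree's `MultipleZetaDuality.dualMap`)
sends the word `011` to `001`; recombine (rule 1b): `R3a ~ [Δ₃, 2/(t₀t₁(1−t₂))]`. (Euler: `Σ H_k/k² = 2ζ(3)`.)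
`R3b` (value `4ζ(3)`): `N = a₁b₀ + q` (`r3b_numerator_split`), so `R3b = T1 + T2`,
`T1 = [ℝ₊³, 1/(a₀b₁)]`, `T2 = [ℝ₊³, q/(a₁b₀a₀b₁)]`, both positive convergent; `uᵢ = xᵢ/(1+xᵢ)` turns
`T1` (after the `x₀`-integration) into `∫∫_{(0,1)²} log(u₂/u₁)/((u₂−u₁)(1−u₁u₂))` whose series is
`2Σ_m (H_{2m} − ½H_m)/m² = (7/2)ζ(3)` via the ALTERNATING Euler sum `Σ(−1)^{k+1}H_k/k² = (5/8)ζ(3)` —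
i.e. the natural continuation of `R3b` passes through LEVEL-TWO words (letter `−1`) and half-integer
multiples of `ζ(3)` (`T1 = 7/2·ζ(3)`, `T2 = ½ζ(3)`, both confirmed to 1e-12, `numerics.txt`). CONSEQUENCE FOR THE ROUTE:
modulo the certified chain, `WheelThreeSpokes ⟺ ([ℝ₊³, N/(a₁b₀a₀b₁)] ~ [Δ₃, 4/(t₀t₁(1−t₂))])`, a
three-dimensional statement of BeukersZeta3 type whose obvious split leaves the MZV letters `{0,1}` —
the first place where a kernel identity beyond `MzvKernelInKZ` (an alternating double-shuffle type
identity, or a cleverer split) is needed. No divergence, no regularised limit anywhere. -/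

/-- `R3a` on the cube: with `x₁ = x/(1−x)`, `x₂ = y/(1−y)`, `z = 1 − s` the integrand times the Jacobian
`1/((1−x)²(1−y)²)` is `1/((1−xy)(1−xyz))`. [folklore] -/
theorem r3a_cube_identity (x y z : ℝ) (hx : x < 1) (hy : y < 1) :
    r3aIntegrand (1 - z) (x / (1 - x)) (y / (1 - y)) * (1 / ((1 - x) ^ 2 * (1 - y) ^ 2)) =
      1 / ((1 - x * y) * (1 - x * y * z)) := by
  have h1 : 1 - x ≠ 0 := by linarith [sub_pos.mpr hx]
  have h2 : 1 - y ≠ 0 := by linarith [sub_pos.mpr hy]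
  unfold r3aIntegrand
  field_simp
  ring

/-- Cube → simplex (`t₀ = x`, `t₁ = xy`, `t₂ = xyz`, Jacobian `x²y = t₀t₁`): the `R3a` integrand becomes
`1/(t₀ · t₁(1−t₁) · (1−t₂))`, and the rule-1b split into the two ADMISSIBLE words `001` and `011`. [folklore] -/
theorem r3a_simplex_split (t0 t1 t2 : ℝ) (h0 : t0 ≠ 0) (h1 : t1 ≠ 0) (h1' : t1 ≠ 1) :
    1 / ((1 - t1) * (1 - t2)) * (1 / (t0 * t1)) =
      1 / (t0 * t1 * (1 - t2)) + 1 / (t0 * (1 - t1) * (1 - t2)) := by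
  have : 1 - t1 ≠ 0 := sub_ne_zero.mpr (Ne.symm h1')
  by_cases h2 : 1 - t2 = 0
  · simp [h2]
  · field_simp
    ring

/-- Duality `(t₀,t₁,t₂) ↦ (1−t₂, 1−t₁, 1−t₀)` (a linear change of variables of determinant `±1`
preserving `Δ₃`) carries the word `011` to the `ζ(3)` word `001`. [folklore] -/
theorem r3a_duality (t0 t1 t2 : ℝ) :
    1 / ((1 - t2) * (1 - (1 - t1)) * (1 - (1 - t0))) = 1 / (t0 * t1 * (1 - t2)) := by
  ring_nf

/-- `R3b`: the numerator splits as `N = a₁b₀ + q`, so `R3b = [ℝ₊³, 1/(a₀b₁)] + [ℝ₊³, q/(a₁b₀a₀b₁)]`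
(`T1 + T2`, values `7/2·ζ(3)` and `½ζ(3)`). [folklore] -/
theorem r3b_numerator_split :
    minA1 x1 x2 * (x1 + x2) * x0 + x1 * x2 * (2 + x1 + x2) = minA1 x1 x2 * minB0 x0 x1 x2 + x1 * x2 := by
  simp [minA1, minB0]; ring

/-- `T1` in the variables `uᵢ = xᵢ/(1+xᵢ)`: the ratio inside the logarithm of the `x₀`-integral,
`x₂(1+x₁)/(x₁(1+x₂))`, is `u₂/u₁` — the source of the letter `−1` (`1 − u₁u₂` below comes from `1+x₁+x₂`).
[folklore] -/
theorem t1_ratio_identity (u1 u2 : ℝ) (h1 : u1 ≠ 0) (h1' : u1 < 1) (h2' : u2 < 1) :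
    (u2 / (1 - u2)) * (1 + u1 / (1 - u1)) / ((u1 / (1 - u1)) * (1 + u2 / (1 - u2))) = u2 / u1 ∧
      1 + u1 / (1 - u1) + u2 / (1 - u2) = (1 - u1 * u2) / ((1 - u1) * (1 - u2)) := by
  have e1 : 1 - u1 ≠ 0 := by linarith [sub_pos.mpr h1']
  have e2 : 1 - u2 ≠ 0 := by linarith [sub_pos.mpr h2']
  constructor
  · field_simp
    ring
  · field_simp
    ring

end PaperChain


/-! ## §7 WHERE THE CRUX NOW STANDS — reduction to the three-dimensional residual, bookkeeping moves
formalised (identity change of variables twice, integrand additivity once) -/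

/-- A genuine instance of rule 2 (identity change of variables): two representations with the same
domain whose integrands agree on it are one move apart. [folklore] -/
theorem of_sub_of_mem_changeOfVariablesRel_of_eqOn {n : ℕ} (r r' : KZ.IntegralRep n)
    (hd : r'.domain = r.domain) (hf : EqOn r.integrand r'.integrand r.domain) :
    KZ.of r - KZ.of r' ∈ KZ.changeOfVariablesRel := by
  refine ⟨n, r, r', id, fun _ => ContinuousLinearMap.id ℝ _, ?_, ?_, ?_, ?_, ?_, rfl⟩
  · exact isSemialgebraicMapOn_id r.isSemialgebraic_domain
  · exact fun x _ => (hasFDerivAt_id x).hasFDerivWithinAt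
  · exact Set.injOn_id _
  · rw [Set.image_id, hd]
  · intro x hx
    have hdet : (ContinuousLinearMap.id ℝ (Fin n → ℝ)).det = 1 := by
      rw [ContinuousLinearMap.det, ContinuousLinearMap.coe_id, LinearMap.det_id]
    simp [hdet, hf hx]

/-- Hence such representations are equivalent. [folklore] -/
theorem equivalent_of_eqOn {n : ℕ} (r r' : KZ.IntegralRep n) (hd : r'.domain = r.domain)
    (hf : EqOn r.integrand r'.integrand r.domain) : KZ.Equivalent r r' :=
  KZ.changeOfVariablesRel_subset_relations (of_sub_of_mem_changeOfVariablesRel_of_eqOn r r' hd hf)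

/-- The target family `[Δ₃, c/(t₀t₁(1−t₂))]`, `c ∈ ℚ` (value `c·ζ(3)`). [folklore] -/
def zetaRepC (c : ℚ) : KZ.IntegralRep 3 where
  domain := simplex3
  integrand := fun t => (c : ℝ) / (t 0 * t 1 * (1 - t 2))
  isSemialgebraic_domain := isSemialgebraic_simplex3
  isSemialgebraicFunOn_integrand := by
    refine (isSemialgebraicFunOn_aeval_div_aeval isSemialgebraic_simplex3 (C c : MvPolynomial (Fin 3) ℚ)
      (X 0 * X 1 * (1 - X 2)) ?_).congr ?_
    · rintro t ⟨h0, h01, h12, h2⟩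
      have : 0 < t 1 := by linarith
      have : 0 < t 0 := by linarith
      have : 0 < 1 - t 2 := by linarith
      simp only [map_mul, map_sub, map_one, aeval_X]
      positivity
    · intro t _
      simp
  integrableOn := by
    have h6 : IntegrableOn (fun t => ((c : ℝ) / 6) * zeta3Integrand t) simplex3 volume :=
      integrableOn_zeta3Integrand.const_mul _
    refine h6.congr_fun (fun t _ => ?_) isOpen_simplex3.measurableSet
    simp only [zeta3Integrand]
    ring

/-- A genuine instance of rule 1b: `[Δ₃, 6/…] − [Δ₃, 2/…] − [Δ₃, 4/…] ∈ integrandAddRel`. [folklore] -/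
theorem zetaRepC_six_split :
    KZ.of (zetaRepC 6) - KZ.of (zetaRepC 2) - KZ.of (zetaRepC 4) ∈ KZ.integrandAddRel := by
  refine ⟨3, zetaRepC 6, zetaRepC 2, zetaRepC 4, rfl, rfl, fun t _ => ?_, rfl⟩
  simp only [zetaRepC, Pi.add_apply]
  push_cast
  ring

/-- The residual data: `R3a = [(0,1)×ℝ₊², r3aIntegrand]` (coordinates `(s, x₁, x₂)`) … [folklore] -/
def Ha (ra : KZ.IntegralRep 3) : Prop :=
  ra.domain = {v | v 0 ∈ Ioo (0 : ℝ) 1 ∧ 0 < v 1 ∧ 0 < v 2} ∧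
    EqOn ra.integrand (fun v => r3aIntegrand (v 0) (v 1) (v 2)) ra.domain

/-- … and `R3b = [ℝ₊³, r3bIntegrand]` (coordinates `(x₀, x₁, x₂)`). [folklore] -/
def Hb (rb : KZ.IntegralRep 3) : Prop :=
  rb.domain = {x | ∀ i, 0 < x i} ∧ EqOn rb.integrand (fun x => r3bIntegrand (x 0) (x 1) (x 2)) rb.domain

/-- **Reduction theorem (shape of the remaining work).** If (i) the paper chain of §5 is formalised
(`[wheelRep] − [ra] − [rb] ∈ relations` for some residual representations), (ii) the `R3a` endgame of
§5 is formalised (`ra ~ [Δ₃, 2/…]`), and (iii) the RESIDUAL CRUX `rb ~ [Δ₃, 4/(t₀t₁(1−t₂))]` holds, then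
`WheelThreeSpokes` holds — for ALL `r, r'` as quantified in the crux, the passage from the canonical
representations being the two identity changes of variables and one integrand-additivity move proved
above. (So a disproof of the crux must now refute (iii) or the formalisation of (i)/(ii).) [folklore] -/
theorem wheelThreeSpokes_of_residual
    (hchain : ∃ ra rb : KZ.IntegralRep 3, Ha ra ∧ Hb rb ∧
      KZ.of wheelRep - KZ.of ra - KZ.of rb ∈ KZ.relations)
    (ha : ∀ ra : KZ.IntegralRep 3, Ha ra → KZ.Equivalent ra (zetaRepC 2))
    (hb : ∀ rb : KZ.IntegralRep 3, Hb rb → KZ.Equivalent rb (zetaRepC 4)) :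
    WheelThreeSpokes := by
  intro r r' h1 h2 h3 h4
  obtain ⟨ra, rb, hra, hrb, hch⟩ := hchain
  have e1 : KZ.of r - KZ.of wheelRep ∈ KZ.relations :=
    KZ.changeOfVariablesRel_subset_relations
      (of_sub_of_mem_changeOfVariablesRel_of_eqOn r wheelRep (by rw [h1]; rfl)
        (fun x hx => by rw [h2 hx]; rfl))
  have e4 : KZ.of (zetaRepC 6) - KZ.of r' ∈ KZ.relations := by
    refine KZ.changeOfVariablesRel_subset_relations
      (of_sub_of_mem_changeOfVariablesRel_of_eqOn (zetaRepC 6) r' (by rw [h3]; rfl) (fun t ht => ?_))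
    have ht' : t ∈ r'.domain := by rw [h3]; exact ht
    rw [h4 ht']
    simp [zetaRepC]
  have e3 : KZ.of (zetaRepC 6) - KZ.of (zetaRepC 2) - KZ.of (zetaRepC 4) ∈ KZ.relations :=
    KZ.integrandAddRel_subset_relations zetaRepC_six_split
  have e2a : KZ.of ra - KZ.of (zetaRepC 2) ∈ KZ.relations := ha ra hra
  have e2b : KZ.of rb - KZ.of (zetaRepC 4) ∈ KZ.relations := hb rb hrb
  have key := add_mem (sub_mem (add_mem (add_mem (add_mem e1 hch) e2a) e2b) e3) e4
  unfold KZ.Equivalent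
  convert key using 1
  abel

end Summit.KontsevichZagierPeriods.KontsevichZagierPeriods.Cruxes.WheelThreeSpokes.Disproof
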